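import Mathlib.Algebra.MvPolynomial.Monad
import Mathlib.Algebra.MvPolynomial.Funext
import Mathlib.RingTheory.MvPolynomial.Basic
import Mathlib.RingTheory.MvPolynomial.WeightedHomogeneous
import Mathlib.Algebra.MvPolynomial.Division
import Mathlib.RingTheory.AlgebraicIndependent.Basic
import Mathlib.Data.Matrix.Basic
import Mathlib.Algebra.CharP.Defs
import Mathlib.Order.PiLex
import Mathlib.RingTheory.Localization.FractionRing
import Literature.Barriers.ValiantsHypothesis.AlgebraicNaturalProofsGenerators
import Literature.Computability.AlgebraicComplexity.SuccinctSVGenerator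
import Literature.Computability.AlgebraicComplexity.ArithCircuitProofs
import HarnessLib

/-!
# FSV18 §4–§5 (+ the summary Thm. 9 / Thm. 10 / Cor. 11 of §1.5): succinct generators via rank
# condensers and via the Shpilka–Volkovich generator (Forbes–Shpilka–Volk 2018)

Cell `val-lit`, typer t18 (DAG row `FSV18-B`); source texts `paper:arxiv-1701.05328` (corpus
chunks `pNNNN.txt:Lnn`, SEQUENTIAL numbering "Thm. 9 … Cor. 49" — the numbering of the tree's
existing `[cite: ForbesShpilkaVolk2018, …]` tags), `paper:doi-10-4086-toc-2018-v014a018` (the bib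
key's published version, Theory of Computing 14(18) 2018, numbered within sections, real pages) and
the arXiv TeX source (exact class names, lost in the corpus text); bib `ForbesShpilkaVolk2018`.
Honest framing: typed literature; `VP ≠ VNP` is NOT proved and nothing here is progress on it. The
results typed are UNCONDITIONAL succinct hitting sets against RESTRICTED classes in the MULTILINEAR
frame (`N = 2^n` coefficient variables); they do not bear on the tree's open crux
`Literature.Barriers.ValiantsHypothesis.SuccinctHittingSetsForVP` (all `poly(N)`-size distinguishers,
regime `d = n`) except as evidence.

**Numbering concordance** (seq. = corpus/arXiv text; ToC = journal): Thm. 9/10, Cor. 11 = ToC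
1.10/1.11/1.12 (pp. 14–17) · §4: Construction 16, Prop. 17, Prop. 18, Fact 19, Lemma 20, Lemma 21,
Cor. 22, Lemma 23, Thm. 24 = ToC 4.1–4.9 (pp. 20–23) · §5: Construction 25, Fact 26, Fact 27,
Lemma 28, Construction 29, Fact 30, Lemma 31, Lemma 32, Lemma 33, Cor. 34, Def. 35, Lemma 36,
Thm. 37, Def. 38, Def. 39, Lemma 40, Lemma 41, Lemma 42, Thm. 43, Cor. 44, Def. 45, Construction 46,
Fact 47, Thm. 48, Cor. 49 = ToC 5.1–5.25 (pp. 23–30).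

**Frame and conventions.** Distinguishers are `N = 2^n`-variate polynomials, the variables being the
multilinear monomials `x_S` of `x_1, …, x_n`: `MvPolynomial (multilinearMonomials n) F` (the tree's
`SuccinctSVGenerator.lean`); the paper's index `i ∈ [N]` of `x_S` is `binIndex` (binary
representation, `0`-based variables). A generator is a polynomial map
`G : multilinearMonomials n → F[seeds]` in the sense of the tree's `IsHittingSetGenerator` (FSV Def. 7
(3)) / `IsSuccinctGenerator` (Def. 7 (2)) / `genOutput`; "`poly(·)`-`ΣΠΣ` succinct" is rendered by
the EXPLICIT class `roProductSums F n K` of read-once affine product sums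
`∑_{j<K} c_j ∏_{i<n} (a_{j,i} x_i + b_{j,i})` (every seed value of every construction of §§4–5 is
such a sum; size `≤ K(2n+1)`, fan-in-two `complexity ≤ K(3n+2)` PROVED, members of the tree's
`SmallCircuits` PROVED, multilinear `ΣΠΣ` formulas of size `≤ K(n+2)` PROVED). `log` in a seed COUNT
is `⌈log₂⌉` where rounding matters (more seeds = the weaker, safe reading: Thm. 43, Construction 46,
Lemma 40) and `⌊log₂⌋` in a support BOUND (Lemma 32: what the printed proof gives); inside `∃ c`
bounds the choice is immaterial. Hitting-set GENERATOR statements are typed over every field (with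
the printed characteristic / size hypotheses); hitting SET statements (Thm. 9, Thm. 10) over an
INFINITE field (FSV §1.2 "large enough fields"; no field hypothesis is printed in Thm. 9).

**Source item → declaration → status** (FACT = named `def … : Prop`, unproved here; PROVED =
theorem; CITE = existing tree declaration).
* Construction 16 → `rcGenCoeff`, `rcPoly` (defs) · Prop. 17 → `bind₁_binaryPowersSubst_rcGenCoeff`
  PROVED (`vdmGenCoeff`, `binaryPowersSubst`) · Prop. 18 → `rcPoly_mem_roProductSums`,
  `complexity_affineProductSum_le` PROVED (clause (b); clause (a), the joint `ΣΠΣΠ` circuit for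
  `P^{RC}(x,y,t)`, has no object in the coordinate-map rendering and is not typed separately) ·
  Fact 19 → `FSV2018_fact19` FACT (uniform `O(k² log d)` clause, see its docstring) · Lemma 20 →
  `isSuccinctGenerator_rcGenCoeff` PROVED · Lemma 21 → `isHittingSetGenerator_rcGenCoeff_of_vdm`
  PROVED (core) · Cor. 22 → `FSV2018_cor22` FACT + `FSV2018_cor22_of_fact19` PROVED · §4.2:
  `TrdegLE`, `trdegProductClass`, `asssPsiGenCoeff`, `trdegGenCoeff` (defs) · Lemma 23 →
  `FSV2018_lemma23` FACT · Thm. 24 → `FSV2018_thm24` FACT + `FSV2018_thm24_of_lemma23`,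
  `isSuccinctGenerator_trdegGenCoeff`, `bind₁_trdegGenCoeff` PROVED.
* Construction 25 → `ssvGenCoeff`, `ssvPoly` (unshifted; the shifted `G^{SSSV}` is the tree's
  `svGenCoeff` / `svPoly`, CITE) · Fact 26 → `ssvPoly_mem_roProductSums`,
  `isSuccinctGenerator_ssvGenCoeff` PROVED · Fact 27 → `ssvGenCoeff_add` PROVED · Lemma 28 →
  `FSV2018_lemma28` + `FSV2018_lemma28_holds` PROVED · Construction 29 → `svPoly_eq_ssvPoly_add` PROVED (rfl) · Fact 30 →
  `svGenCoeff_eq_ssvGenCoeff_add_one` (rfl), `svPoly_mem_roProductSums`,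
  `isSuccinctGenerator_svGenCoeff` PROVED · Lemma 31 → `FSV2018_lemma31` + `FSV2018_lemma31_holds`
  PROVED (from Lemma 28) · Lemma 32 →
  `FSV2018_lemma32`, DISCHARGED in `FSV18SparseHittingProofs.lean` (`FSV2018_lemma32_holds`, via
  `FSV18SparseShift.lean`, val-lit t19) · Lemma 33 → `FSV2018_lemma33` CORRECTED (erratum: printed "at most
  `s` monomials" is false; "at least" is what [FSTW16, Prop. 6.14] proves and the proof of Lemma 32
  uses) + `FSV2018_lemma33_holds` PROVED (induction on the variables of `P`, top/bottom
  `X_i`-slices) · Cor. 34 → the tree's fact `ForbesShpilkaVolk2018_svGeneratorHitsSparse`,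
  DISCHARGED in `FSV18SparseHittingProofs.lean` (succinctness PROVED here:
  `isSuccinctGenerator_svGenCoeff`) ·
  Def. 35 → `smespClass` · Lemma 36 → `FSV2018_lemma36` FACT · Thm. 37 → `FSV2018_thm37` FACT +
  `FSV2018_thm37_of_lemma36_of_lemma31`, `FSV2018_thm37_of_lemma36` PROVED.
* §5.3: `IsROABP`, `IsCommROABP`, `IsCommROABPMatrix`, `commROABPClass` (defs) · Def. 38 →
  `IsIndepMonomialMap` · Def. 39 → `IsRankConcentrated` (Hasse/Taylor-coefficient reading) ·
  Lemma 40 → `FSV2018_lemma40` FACT (finite variable set) · Lemma 41 → `FSV2018_lemma41` FACT (scope `k ≤ 2^n`, see its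
  docstring) · Lemma 42 →
  `FSV2018_lemma42`, DISCHARGED in `FSV18CommROABPProofs.lean` (`FSV2018_lemma42_holds`, val-lit
  t19) · Thm. 43 → `FSV2018_thm43` FACT · Cor. 44 → `FSV2018_cor44` FACT +
  `FSV2018_cor44_of_thm43` PROVED.
* Def. 45 → `OccurFormula` (+ `OccurArgs`, `OccurPowArgs`; `eval`, `size` — a leaf counts the
  wires of its `ΣΠ` formula, bounding sparsity AND degree as [ASSS16] need —, `depth`, `occur`),
  `occurClass` · Construction 46 → `asssR`, `asssK`, `asssGenCoeff` · Fact 47 →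
  `isSuccinctGenerator_asssGenCoeff` PROVED · Thm. 48 → `FSV2018_thm48` FACT (`r_ℓ ≤ R`), DISCHARGED
  2026-08-27 (`FSV2018_thm48_holds`, `FSV18Thm48Holds.lean`) · Cor. 49 → `FSV2018_cor49` FACT
  (hitting half; succinctness = Fact 47), DISCHARGED (`FSV2018_cor49_holds`, `FSV18Cor49Holds.lean`).
* Thm. 9 → `FSV2018_thm9` = conjunction of `FSV2018_thm9_{spsk, trdeg, sparse, smesp, commROABP,
  occur, sparseTrdeg}` FACTS over `multilinearSPS` / `MultilinearSPSHits` (the sparse bullet is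
  DISCHARGED: `FSV2018_thm9_sparse_holds` in `FSV18SparseHittingProofs.lean`); PROVED reductions
  `FSV2018_thm9_sparse_of_svGeneratorHitsSparse`, `FSV2018_thm9_spsk_of_cor22`,
  `FSV2018_thm9_trdeg_of_thm24`, `FSV2018_thm9_smesp_of_thm37`, `FSV2018_thm9_commROABP_of_cor44`,
  via `multilinearSPSHits_of_generator` (FSV Lemma 14 = the tree's
  `isSuccinctHittingSet_of_generator`) · Thm. 10 → `FSV2018_thm10` FACT (`IsMonomialCompatible`) ·
  Cor. 11 → `FSV2018_cor11_of_hits` PROVED schema (FSV Thm. 4 = the tree's `exists_isNaturalProof_iff`).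
* Left to the §6–8 seat: Def. 50–Cor. 54 (over this file's `sparseTrdegClass` / `TrdegLE`),
  Lemma 55–Cor. 60 (over `IsROABP` / `IsMonomialCompatible`), §8.

**Net of facts.** Every FACT here is a printed statement of [ForbesShpilkaVolk2018] or of the
work it cites ([SY10]/[SS13] Fact 19, [ASSS16] Lemma 23 / Thm. 48, [Forbes15, GKST16] Lemma 32,
[FSTW16] Lemma 33, [Forbes15] Lemma 36, [FSS14] Lemmas 40, 42); the `_of_` theorems record the
paper's internal implications so that discharging the leaves (Fact 19, Lemma 23, Lemma 36,
Lemma 40/41/42 → Thm. 43, Thm. 48 → Cor. 49, Thm. 10) discharges the rest; Lemmas 28, 31 and 33 are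
discharged in this file, Lemma 32 / Cor. 34 / Thm. 9's sparse bullet in `FSV18SparseHittingProofs.lean`.

## References

* [ForbesShpilkaVolk2018] M. A. Forbes, A. Shpilka, B. L. Volk, *Succinct hitting sets and barriers
  to proving lower bounds for algebraic circuits*, Theory Comput. 14 (2018) 18:1–45 (STOC 2017;
  arXiv:1701.05328): Thm. 9, Thm. 10, Cor. 11 (ToC 1.10–1.12); §4 items 16–24 (ToC 4.1–4.9); §5
  items 25–49 (ToC 5.1–5.25); §7.1 (monomial-compatible orderings).
* [SaxenaSeshadhri2012] N. Saxena, C. Seshadhri, rank bounds / blackbox PIT for `Σ^kΠΣ` (the tree's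
  `SaxenaSeshadhri2012_lemma11`; source of the rank bounds quoted in Fact 19 via [SY10]).
* [ASSS16] M. Agrawal, C. Saha, R. Saptharishi, N. Saxena, *Jacobian hits circuits*, SIAM J. Comput.
  45 (2016) (Lemma 23, Def. 45, Thm. 48). [FSS14] M. A. Forbes, R. Saptharishi, A. Shpilka, STOC 2014
  (Def. 38, Lemmas 40, 42). [FSTW16] M. A. Forbes, A. Shpilka, I. Tzameret, A. Wigderson (Lemma 33 =
  Prop. 6.14). [Forbes15] M. A. Forbes, PhD thesis (Lemmas 32, 36). [GKST16] R. Gurjar, A. Korwar,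
  N. Saxena, T. Thierauf (Lemma 32).
-/

noncomputable section

namespace Literature.Computability.AlgebraicComplexity

open MvPolynomial Finset Literature.Barriers.ValiantsHypothesis

/-! ## Common vocabulary: the binary index of a multilinear monomial; read-once affine product sums -/

section Common

variable (F : Type*) [CommRing F] {n : ℕ}

/-- The paper's identification of `[N] = [2^n]` with subsets of `[n]` ("an index `i ∈ [N]` gets
mapped to `S ⊆ [n]` via its binary representation so that `i - 1 = ∑_{k ∈ S} 2^{k-1}`", proof of
Prop. 17), in the tree's `0`-based variables: the multilinear monomial `x^m = x_S`, `S = supp m`,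
has index `i_S = 1 + ∑_{k ∈ S} 2^k ∈ {1, …, 2^n}`.
[cite: ForbesShpilkaVolk2018, Prop. 17 (seq.) = ToC Prop. 4.2, p. 21 (proof)]
locator: paper:arxiv-1701.05328 p0016.txt:L19; paper:doi-10-4086-toc-2018-v014a018 p0021.txt:L2 -/
def binIndex (m : Fin n →₀ ℕ) : ℕ :=
  1 + ∑ k ∈ m.support, 2 ^ (k : ℕ)

/-- **Read-once affine product sums** `∑_{j<k} c_j ∏_{i<n} (a_{j,i} x_i + b_{j,i})`: the common
normal form of ALL succinct hitting sets of FSV §4–§5 (each seed value of `P^{RC}`, `Q^{SSV}`,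
`Q^{SSSV}`, `P^{ASSS}`, `G^{BMS}` is such a sum) — a depth-3 multilinear `ΣΠΣ` formula of top
fan-in `k` whose product gates multiply `n` univariate affine forms in distinct variables ("these
formulas will be fooled by hitting sets which are themselves depth-3 formulas, but of
polylogarithmic complexity", §1.5). [cite: ForbesShpilkaVolk2018, §1.5 and Prop. 18 / Fact 26 (seq.) = ToC §1.5, Prop. 4.3, Fact 5.2]
locator: paper:arxiv-1701.05328 p0010.txt:L21; paper:doi-10-4086-toc-2018-v014a018 p0014.txt:L40 -/
def affineProductSum (n k : ℕ) (c : Fin k → F) (a b : Fin k → Fin n → F) : MvPolynomial (Fin n) F :=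
  ∑ j : Fin k, C (c j) * ∏ i : Fin n, (C (a j i) * X i + C (b j i))

/-- The class of read-once affine product sums with top fan-in `k` in `x_1, …, x_n` (size
`≤ k(2n+1)`: `k` product gates, `kn` affine forms). [cite: ForbesShpilkaVolk2018, §1.5 (seq.) = ToC §1.5, p. 14]
locator: paper:doi-10-4086-toc-2018-v014a018 p0014.txt:L40 -/
def roProductSums (n k : ℕ) : Set (MvPolynomial (Fin n) F) :=
  {f | ∃ (c : Fin k → F) (a b : Fin k → Fin n → F), f = affineProductSum F n k c a b}

variable {F}

/-- Coefficients of a read-once affine product sum ("taking `P` as a multilinear polynomial in `x`",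
Constructions 16 / 25): at a multilinear `m` with `S = supp m` it is
`∑_j c_j ∏_{i ∈ S} a_{j,i} ∏_{i ∉ S} b_{j,i}`, and `0` off the multilinear monomials.
[cite: ForbesShpilkaVolk2018, Constructions 16 and 25 (seq.) = ToC Constructions 4.1 and 5.1, pp. 20, 23] -/
theorem coeff_affineProductSum (k : ℕ) (c : Fin k → F) (a b : Fin k → Fin n → F)
    (m : Fin n →₀ ℕ) :
    coeff m (affineProductSum F n k c a b) =
      if m ∈ multilinearMonomials n then
        ∑ j : Fin k, c j * ((∏ i ∈ m.support, a j i) * ∏ i ∈ m.supportᶜ, b j i)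
      else 0 := by
  rw [affineProductSum, coeff_sum]
  simp_rw [coeff_C_mul, coeff_prod_C_mul_X_add_C]
  split_ifs with hm
  · rfl
  · simp

/-- Read-once affine product sums are multilinear (they live in "the space of multilinear
polynomials", §1.5 / Constructions 16, 25). [cite: ForbesShpilkaVolk2018, Constructions 16 and 25 (seq.) = ToC Constructions 4.1 and 5.1, pp. 20, 23] -/
theorem coeff_affineProductSum_eq_zero (k : ℕ) (c : Fin k → F) (a b : Fin k → Fin n → F)
    {m : Fin n →₀ ℕ} (hm : m ∉ multilinearMonomials n) :
    coeff m (affineProductSum F n k c a b) = 0 := by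
  rw [coeff_affineProductSum, if_neg hm]

/-- A multilinear exponent vector in `n` variables has degree `≤ n`. [folklore] -/
private theorem degree_le_of_mem_multilinearMonomials {m : Fin n →₀ ℕ} (hm : m ∈ multilinearMonomials n) :
    m.degree ≤ n := by
  calc m.degree = ∑ i ∈ m.support, m i := rfl
    _ ≤ ∑ i ∈ m.support, 1 := Finset.sum_le_sum fun i _ => hm i
    _ = m.support.card := by simp
    _ ≤ n := by simpa using Finset.card_le_univ m.support

/-- Read-once affine product sums have total degree `≤ n` (multilinear in `x_1, …, x_n`,
§1.5 / Prop. 18). [cite: ForbesShpilkaVolk2018, Prop. 18 (seq.) = ToC Prop. 4.3, p. 21] -/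
theorem totalDegree_affineProductSum_le (k : ℕ) (c : Fin k → F) (a b : Fin k → Fin n → F) :
    (affineProductSum F n k c a b).totalDegree ≤ n := by
  rw [totalDegree]
  refine Finset.sup_le fun m hm => ?_
  by_cases h : m ∈ multilinearMonomials n
  · exact degree_le_of_mem_multilinearMonomials h
  · exact absurd (coeff_affineProductSum_eq_zero k c a b h) (mem_support_iff.1 hm)

/-- **Succinctness in the tree's size measure (PROVED):** a read-once affine product sum with top
fan-in `k` has fan-in-two circuit complexity `≤ k(3n+2)` (each affine form `a x_i + b` costs `≤ 2`,
each `n`-fold product `≤ n` more, each scalar `≤ 1`, the top sum `≤ k`) — FSV's "`poly(n,k)`-size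
`ΣΠΣ` circuit" (Prop. 18, Fact 26, Fact 30) in the measure `complexity` of `SmallCircuits`.
[cite: ForbesShpilkaVolk2018, Prop. 18 and Fact 26 (seq.) = ToC Prop. 4.3 and Fact 5.2, pp. 21, 23]
locator: paper:arxiv-1701.05328 p0016.txt:L43; paper:doi-10-4086-toc-2018-v014a018 p0021.txt:L70 -/
theorem complexity_affineProductSum_le (k : ℕ) (c : Fin k → F) (a b : Fin k → Fin n → F) :
    complexity (affineProductSum F n k c a b) ≤ k * (3 * n + 2) := by
  have hform : ∀ (j : Fin k) (i : Fin n),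
      complexity (C (a j i) * X i + C (b j i) : MvPolynomial (Fin n) F) ≤ 2 := fun j i => by
    calc complexity (C (a j i) * X i + C (b j i) : MvPolynomial (Fin n) F)
        ≤ complexity (C (a j i) * X i : MvPolynomial (Fin n) F) + complexity (C (b j i) : MvPolynomial (Fin n) F) + 1 :=
          complexity_add_le_holds _ _
      _ ≤ (complexity (C (a j i) : MvPolynomial (Fin n) F) + complexity (X i : MvPolynomial (Fin n) F) + 1) + 0 + 1 := by
          gcongr
          · exact complexity_mul_le_holds _ _
          · exact (complexity_C_holds (σ := Fin n) (b j i)).le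
      _ = 2 := by rw [complexity_C_holds, complexity_X_holds]
  have hprod : ∀ j : Fin k,
      complexity (∏ i : Fin n, (C (a j i) * X i + C (b j i)) : MvPolynomial (Fin n) F) ≤ 3 * n := fun j => by
    calc complexity (∏ i : Fin n, (C (a j i) * X i + C (b j i)) : MvPolynomial (Fin n) F)
        ≤ ∑ i : Fin n, complexity (C (a j i) * X i + C (b j i) : MvPolynomial (Fin n) F) + (univ : Finset (Fin n)).card :=
          complexity_finset_prod_le _ _
      _ ≤ ∑ _i : Fin n, 2 + (univ : Finset (Fin n)).card := by gcongr with i; exact hform j i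
      _ = 3 * n := by simp; ring
  have hterm : ∀ j : Fin k,
      complexity (C (c j) * ∏ i : Fin n, (C (a j i) * X i + C (b j i)) : MvPolynomial (Fin n) F) ≤ 3 * n + 1 := fun j => by
    calc complexity (C (c j) * ∏ i : Fin n, (C (a j i) * X i + C (b j i)) : MvPolynomial (Fin n) F)
        ≤ complexity (C (c j) : MvPolynomial (Fin n) F) + complexity (∏ i : Fin n, (C (a j i) * X i + C (b j i)) : MvPolynomial (Fin n) F) + 1 :=
          complexity_mul_le_holds _ _
      _ ≤ 0 + 3 * n + 1 := by
          gcongr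
          · exact (complexity_C_holds (σ := Fin n) (c j)).le
          · exact hprod j
      _ = 3 * n + 1 := by ring
  calc complexity (affineProductSum F n k c a b)
      ≤ ∑ j : Fin k, complexity (C (c j) * ∏ i : Fin n, (C (a j i) * X i + C (b j i)) : MvPolynomial (Fin n) F) + (univ : Finset (Fin k)).card :=
        complexity_finset_sum_le _ _
    _ ≤ ∑ _j : Fin k, (3 * n + 1) + (univ : Finset (Fin k)).card := by gcongr with j; exact hterm j
    _ = k * (3 * n + 2) := by simp; ring

/-- The sum of two read-once affine product sums (top fan-ins `k₁`, `k₂`) is one with top fan-in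
`k₁ + k₂` ("`poly(k,n)`-`ΣΠΣ` circuits are closed under addition", proof of Thm. 24).
[cite: ForbesShpilkaVolk2018, Thm. 24 (seq.) = ToC Thm. 4.9, p. 23 (proof)]
locator: paper:doi-10-4086-toc-2018-v014a018 p0023.txt:L2 -/
theorem add_mem_roProductSums {k₁ k₂ : ℕ} {f g : MvPolynomial (Fin n) F}
    (hf : f ∈ roProductSums F n k₁) (hg : g ∈ roProductSums F n k₂) :
    f + g ∈ roProductSums F n (k₁ + k₂) := by
  obtain ⟨c₁, a₁, b₁, rfl⟩ := hf
  obtain ⟨c₂, a₂, b₂, rfl⟩ := hg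
  refine ⟨Fin.append c₁ c₂, Fin.append a₁ a₂, Fin.append b₁ b₂, ?_⟩
  rw [affineProductSum, affineProductSum, affineProductSum, Fin.sum_univ_add]
  simp

/-- The zero polynomial is a read-once affine product sum of any top fan-in (all `c_j = 0`).
[folklore] -/
private theorem zero_mem_roProductSums (k : ℕ) : (0 : MvPolynomial (Fin n) F) ∈ roProductSums F n k :=
  ⟨fun _ => 0, fun _ _ => 0, fun _ _ => 0, by simp [affineProductSum]⟩

/-- Padding: a product sum with top fan-in `k` is one with any larger top fan-in (extra terms with
`c_j = 0`; "by possibly restricting excess `y_ℓ` variables to `0`", proof of Cor. 49).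
[cite: ForbesShpilkaVolk2018, Cor. 49 (seq.) = ToC Cor. 5.25, p. 30 (proof)] -/
theorem roProductSums_mono {k k' : ℕ} (h : k ≤ k') : roProductSums F n k ⊆ roProductSums F n k' := by
  intro f hf
  have := add_mem_roProductSums hf (zero_mem_roProductSums (F := F) (n := n) (k' - k))
  rwa [add_zero, Nat.add_sub_cancel' h] at this

end Common

section CommonField

variable {F : Type*} [Field F] {n : ℕ}

/-- **Bridge to the tree's simple class (PROVED):** a read-once affine product sum with
`k(3n+2) ≤ n^b` lies in `SmallCircuits F n b` (degree `≤ n`, complexity `≤ n^b`) — so every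
succinct hitting set of FSV §4–§5 consists of members of the simple class of the tree's barrier
frame `Literature.Barriers.ValiantsHypothesis.SmallCircuits`. [cite: ForbesShpilkaVolk2018, Cor. 5 and §1.5 (seq.) = ToC Cor. 1.5, §1.5]
locator: paper:doi-10-4086-toc-2018-v014a018 p0014.txt:L40 -/
theorem affineProductSum_mem_smallCircuits {k b : ℕ} (hkb : k * (3 * n + 2) ≤ n ^ b)
    (c : Fin k → F) (a b' : Fin k → Fin n → F) :
    affineProductSum F n k c a b' ∈ SmallCircuits F n b :=
  ⟨totalDegree_affineProductSum_le k c a b', (complexity_affineProductSum_le k c a b').trans hkb⟩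

end CommonField

/-! ## §4 Succinct hitting sets via rank condensers -/

section RankCondenser

variable (F : Type*) [CommRing F] {n : ℕ}

/-- **FSV Construction 16 (ToC 4.1), the succinct rank condenser, as a polynomial map.** Printed:
"`P^{RC}_{n,r}(x,y,t) = ∑_{j=1}^r y_j t_0^j ∏_{k=1}^n (1 + x_k t_k^j)` … Let `G^{RC}_{n,r}(y,t)` be
the polynomial map given by `coeff_x(P^{RC}_{n,r})` when taking `P^{RC}_{n,r}` as a multilinear
polynomial in `x`." Its coordinate at the multilinear monomial `x_S` (`S = supp m`) is
`∑_{j=1}^r y_j t_0^j ∏_{k ∈ S} t_k^j`; seed variables `y_j = Sum.inl j` (`j : Fin r`, printed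
index `j+1`) and `t_0, …, t_n = Sum.inr 0, …, Sum.inr n` (`t_k` for the variable `x_k`, `k : Fin n`,
is `Sum.inr k.succ`). [cite: ForbesShpilkaVolk2018, Construction 16 (seq.) = ToC Construction 4.1, p. 20]
locator: paper:arxiv-1701.05328 p0016.txt:L9; paper:doi-10-4086-toc-2018-v014a018 p0020.txt:L33 -/
def rcGenCoeff (n r : ℕ) (m : Fin n →₀ ℕ) : MvPolynomial (Fin r ⊕ Fin (n + 1)) F :=
  ∑ j : Fin r, X (Sum.inl j) * X (Sum.inr 0) ^ ((j : ℕ) + 1) *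
    ∏ k ∈ m.support, X (Sum.inr k.succ) ^ ((j : ℕ) + 1)

/-- **`P^{RC}_{n,r}(x, α, β)` at a seed** `(α, β) ∈ 𝔽^r × 𝔽^{n+1}`:
`∑_j α_j β_0^{j+1} ∏_k (β_{k+1}^{j+1} x_k + 1)` — a read-once affine product sum with top fan-in `r`
(Prop. 18: "for every fixing `y = α`, `t = β`, `P^{RC}_{n,r}(x,α,β)` is computed by a `ΣΠΣ` circuit
of size `poly(r,n)`"). [cite: ForbesShpilkaVolk2018, Construction 16 and Prop. 18 (seq.) = ToC 4.1 and 4.3, pp. 20–21]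
locator: paper:arxiv-1701.05328 p0016.txt:L43; paper:doi-10-4086-toc-2018-v014a018 p0021.txt:L70 -/
def rcPoly (n r : ℕ) (α : Fin r → F) (β : Fin (n + 1) → F) : MvPolynomial (Fin n) F :=
  affineProductSum F n r (fun j => α j * β 0 ^ ((j : ℕ) + 1))
    (fun j k => β k.succ ^ ((j : ℕ) + 1)) (fun _ _ => 1)

/-- **Prop. 17's target: the Gabizon–Raz rank condenser / Vandermonde map with a formal `t`.** The
polynomial map `X_i ↦ ∑_{j=1}^r y_j t^{ij}` (Fact 19: "`V : 𝔽^r → 𝔽^N` the linear transformation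
given by the `N × r` Vandermonde matrix `(V_t)_{ij} = t^{ij}`"), coordinate `i = i_S = binIndex m`,
seed variables `y_j = Sum.inl j` and `t = Sum.inr ()`.
[cite: ForbesShpilkaVolk2018, Prop. 17 and Fact 19 (seq.) = ToC Prop. 4.2 and Fact 4.4, pp. 21–22]
locator: paper:arxiv-1701.05328 p0016.txt:L54; paper:doi-10-4086-toc-2018-v014a018 p0022.txt:L2 -/
def vdmGenCoeff (n r : ℕ) (m : Fin n →₀ ℕ) : MvPolynomial (Fin r ⊕ Unit) F :=
  ∑ j : Fin r, X (Sum.inl j) * X (Sum.inr ()) ^ (((j : ℕ) + 1) * binIndex m)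

/-- The substitution of Prop. 17: `y ↦ y`, `t_0 ↦ t`, `t_k ↦ t^{2^{k-1}}` (`k = 1, …, n`; in the
tree's indexing `Sum.inr i.succ ↦ t^{2^i}`). [cite: ForbesShpilkaVolk2018, Prop. 17 (seq.) = ToC Prop. 4.2, p. 21]
locator: paper:doi-10-4086-toc-2018-v014a018 p0021.txt:L2 -/
def binaryPowersSubst (n r : ℕ) : Fin r ⊕ Fin (n + 1) → MvPolynomial (Fin r ⊕ Unit) F :=
  Sum.elim (fun j => X (Sum.inl j)) (Fin.cases (X (Sum.inr ())) fun i => X (Sum.inr ()) ^ (2 ^ (i : ℕ)))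

variable {F}

/-- The generator's output at a seed: `G^{RC}_{n,r}(α, β)_m = ∑_j α_j β_0^{j+1} ∏_{k ∈ supp m} β_{k+1}^{j+1}`.
[cite: ForbesShpilkaVolk2018, Construction 16 (seq.) = ToC Construction 4.1, p. 20] -/
theorem eval_rcGenCoeff (r : ℕ) (α : Fin r → F) (β : Fin (n + 1) → F) (m : Fin n →₀ ℕ) :
    eval (Sum.elim α β) (rcGenCoeff F n r m) =
      ∑ j : Fin r, α j * β 0 ^ ((j : ℕ) + 1) * ∏ k ∈ m.support, β k.succ ^ ((j : ℕ) + 1) := by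
  simp [rcGenCoeff, map_sum, map_mul, map_prod, map_pow]

/-- **`coeff_x(P^{RC}) = G^{RC}` at every seed (PROVED):** the coefficient of the multilinear
monomial `x^m` in `P^{RC}_{n,r}(x,α,β)` is `G^{RC}_{n,r}(α,β)_m`.
[cite: ForbesShpilkaVolk2018, Construction 16 (seq.) = ToC Construction 4.1, p. 20]
locator: paper:doi-10-4086-toc-2018-v014a018 p0020.txt:L49 -/
theorem coeff_rcPoly_eq_eval_rcGenCoeff (r : ℕ) (α : Fin r → F) (β : Fin (n + 1) → F)
    {m : Fin n →₀ ℕ} (hm : m ∈ multilinearMonomials n) :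
    coeff m (rcPoly F n r α β) = eval (Sum.elim α β) (rcGenCoeff F n r m) := by
  rw [rcPoly, coeff_affineProductSum, if_pos hm, eval_rcGenCoeff]
  refine Finset.sum_congr rfl fun j _ => ?_
  simp [mul_assoc]

/-- `P^{RC}_{n,r}(x,α,β)` is a read-once affine product sum with top fan-in `r` (Prop. 18, second
sentence, PROVED). [cite: ForbesShpilkaVolk2018, Prop. 18 (seq.) = ToC Prop. 4.3, p. 21]
locator: paper:arxiv-1701.05328 p0016.txt:L43; paper:doi-10-4086-toc-2018-v014a018 p0021.txt:L70 -/
theorem rcPoly_mem_roProductSums (r : ℕ) (α : Fin r → F) (β : Fin (n + 1) → F) :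
    rcPoly F n r α β ∈ roProductSums F n r :=
  ⟨_, _, _, rfl⟩

/-- **Succinctness of the rank condenser (Lemma 20, first sentence, PROVED):** every output of
`G^{RC}_{n,r}` is the coefficient vector of a read-once affine product sum with top fan-in `r`
("The polynomial map `G^{RC}_{n,R(k,d)}(y,t)` is `poly(R(k,d), n)`-`ΣΠΣ` succinct").
[cite: ForbesShpilkaVolk2018, Lemma 20 (seq.) = ToC Lemma 4.5, p. 22]
locator: paper:arxiv-1701.05328 p0016.txt:L61; paper:doi-10-4086-toc-2018-v014a018 p0022.txt:L11 -/
theorem isSuccinctGenerator_rcGenCoeff (r : ℕ) :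
    IsSuccinctGenerator (multilinearMonomials n) (roProductSums F n r)
      (fun m : multilinearMonomials n => rcGenCoeff F n r (m : Fin n →₀ ℕ)) := by
  intro a
  refine ⟨rcPoly F n r (fun j => a (Sum.inl j)) (fun k => a (Sum.inr k)),
    rcPoly_mem_roProductSums _ _ _, ?_⟩
  have ha : (Sum.elim (fun j => a (Sum.inl j)) fun k => a (Sum.inr k)) = a := by
    funext v; cases v <;> rfl
  funext m
  rw [coeffVector_apply, genOutput_apply, coeff_rcPoly_eq_eval_rcGenCoeff _ _ _ m.2, ha]

/-- **FSV Prop. 17 (ToC Prop. 4.2), PROVED:** under `t_0 ↦ t`, `t_k ↦ t^{2^{k-1}}` the succinct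
rank condenser becomes the Vandermonde rank condenser: "Taking `N = 2^n`, identify `[N]` with
`2^{[n]}`. Then for every `i ∈ [N]`, `(G^{RC}_{n,r}(y, t, t^{2^0}, t^{2^1}, …, t^{2^{n-1}}))_i = ∑_{j=1}^r y_j t^{ij}`."
[cite: ForbesShpilkaVolk2018, Prop. 17 (seq.) = ToC Prop. 4.2, p. 21]
locator: paper:arxiv-1701.05328 p0016.txt:L19; paper:doi-10-4086-toc-2018-v014a018 p0021.txt:L2 -/
theorem bind₁_binaryPowersSubst_rcGenCoeff (r : ℕ) (m : Fin n →₀ ℕ) :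
    bind₁ (binaryPowersSubst F n r) (rcGenCoeff F n r m) = vdmGenCoeff F n r m := by
  rw [rcGenCoeff, vdmGenCoeff, map_sum]
  refine Finset.sum_congr rfl fun j _ => ?_
  rw [map_mul, map_mul, map_pow, map_prod, bind₁_X_right, bind₁_X_right]
  simp_rw [map_pow, bind₁_X_right]
  simp only [binaryPowersSubst, Sum.elim_inl, Sum.elim_inr, Fin.cases_zero, Fin.cases_succ]
  rw [mul_assoc]
  congr 1
  simp_rw [← pow_mul]
  rw [Finset.prod_pow_eq_pow_sum, ← pow_add]
  congr 1
  rw [binIndex, Nat.mul_add, Nat.mul_one, Finset.mul_sum]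
  congr 1
  exact Finset.sum_congr rfl fun k _ => by ring

/-- **FSV Lemma 21, its logical core (PROVED):** a class hit by the Vandermonde map
`X_i ↦ ∑_j y_j t^{ij}` is hit by the succinct rank condenser `G^{RC}_{n,r}` ("Immediate from
Prop. 17 (making the appropriate substitution for `t`) and Fact 19"): a specialisation of
`D ∘ G^{RC}` is nonzero, hence so is `D ∘ G^{RC}`.
[cite: ForbesShpilkaVolk2018, Lemma 21 (seq.) = ToC Lemma 4.6, p. 22]
locator: paper:arxiv-1701.05328 p0016.txt:L70; paper:doi-10-4086-toc-2018-v014a018 p0022.txt:L16 -/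
theorem isHittingSetGenerator_rcGenCoeff_of_vdm (r : ℕ)
    {𝒟 : Set (MvPolynomial (multilinearMonomials n) F)}
    (h : IsHittingSetGenerator 𝒟 (fun m : multilinearMonomials n => vdmGenCoeff F n r (m : Fin n →₀ ℕ))) :
    IsHittingSetGenerator 𝒟 (fun m : multilinearMonomials n => rcGenCoeff F n r (m : Fin n →₀ ℕ)) := by
  intro D hD hD0 hcomp
  refine h D hD hD0 ?_
  have := congrArg (bind₁ (binaryPowersSubst F n r)) hcomp
  rw [bind₁_bind₁, map_zero] at this
  simp_rw [bind₁_binaryPowersSubst_rcGenCoeff] at this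
  exact this

end RankCondenser

/-! ### §4.1 Depth-3 formulas with bounded top fan-in (`Σ^kΠΣ`) -/

section Spsk

variable (F : Type*) [CommRing F]

/-- **`Σ^kΠΣ` formulas** (§4.1: "a depth-3 formula of the form `∑_{i=1}^k ∏_{j=1}^{d_i} ℓ_{i,j}`,
where `ℓ_{i,j}` are linear functions in `X_1, …, X_N`. We denote the degree of the circuit by
`d = max_i d_i`") in variables `ι`, as a class: `k` products of at most `d` polynomials of total
degree `≤ 1` each (the rendering of the tree's `SaxenaSeshadhri2012_lemma11`).
[cite: ForbesShpilkaVolk2018, §4.1 (seq. p. 16) = ToC §4.1, p. 21]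
locator: paper:arxiv-1701.05328 p0016.txt:L46; paper:doi-10-4086-toc-2018-v014a018 p0021.txt:L75 -/
def spskClass (ι : Type*) (k d : ℕ) : Set (MvPolynomial ι F) :=
  {f | ∃ (dd : Fin k → ℕ) (ℓ : (i : Fin k) → Fin (dd i) → MvPolynomial ι F),
    (∀ i, dd i ≤ d) ∧ (∀ i j, (ℓ i j).totalDegree ≤ 1) ∧ f = ∑ i, ∏ j, ℓ i j}

end Spsk

/-- **FSV Fact 19 (ToC Fact 4.4; from the survey [Shpilka–Yehudayoff 2010], rank bounds of
[Saxena–Seshadhri]) — NAMED FACT.** Printed: "Let `F(X) ∈ 𝔽[X]` be a polynomial computed by a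
`Σ^kΠΣ` degree `d` formula. Let `V : 𝔽^r → 𝔽^N` the linear transformation given by the `N × r`
Vandermonde matrix `(V_t)_{ij} = t^{i·j}` for `1 ≤ i ≤ N`, `1 ≤ j ≤ r`. Then, for `r = R(k,d)+1`
where `R(k,d) = O(k² log d)` (over finite fields) or `R(k,d) = k²` (over infinite fields), it holds
that `F ≠ 0` if and only if the `r`-variate polynomial `F ∘ (V_t · (y_1, …, y_r)^T)` is
non-zero." Rendering: the ONE clause implied by both printed clauses and proved over every field
in the rank-bound literature — a universal constant `c` with `r = c·k²·(⌊log₂ d⌋ + 1) + 1` (for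
infinite fields print claims the `d`-free `k² + 1`, which is STRONGER than what is typed here; the
`d`-independent rank bounds are proved via Sylvester–Gallai theorems over `ℝ`, so the typed uniform
clause is the safe reading); `N = 2^n` with coordinate `i = binIndex m` (the class `Σ^kΠΣ` is
invariant under permuting variables, so the identification is immaterial); "`F ≠ 0` iff
`F ∘ V ≠ 0`" = the Vandermonde map with formal `t` is a hitting-set generator (the "if" is trivial).
DISCHARGED (val-lit t18 g3, 2026-08-26): `FSV2018_fact19_holds` in `FSV18Fact19Holds.lean` (p457528),
from the tree's PROVED Saxena–Seshadhri variable reduction (`SaxenaSeshadhri2012_lemma11`, the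
transcendental-`β` form `SaxenaSeshadhri.aeval_vandermonde_generic_ne_zero`) — indeed EVERY seed
count `r ≥ k` works over every field (`isHittingSetGenerator_vdmGenCoeff_spsk_of_le`), so both
printed clauses hold and the infinite-field caveat above is moot.
[cite: ForbesShpilkaVolk2018, Fact 19 (seq.) = ToC Fact 4.4, p. 22]
locator: paper:arxiv-1701.05328 p0016.txt:L54; paper:doi-10-4086-toc-2018-v014a018 p0022.txt:L2 -/
def FSV2018_fact19 : Prop :=
  ∃ c : ℕ, ∀ (F : Type) [Field F] (n k d : ℕ),
    IsHittingSetGenerator (spskClass F (multilinearMonomials n) k d)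
      (fun m : multilinearMonomials n =>
        vdmGenCoeff F n (c * k ^ 2 * (Nat.log 2 d + 1) + 1) (m : Fin n →₀ ℕ))

/-- **FSV Cor. 22 (ToC Cor. 4.7) — NAMED FACT:** "`G^{RC}_{n,R(k,d)}(y,t)` is a
`poly(k, log d, n)`-`ΣΠΣ` succinct generator for the class of `Σ^kΠΣ` formulas" (Lemma 20:
succinctness; Lemma 21: "Let `F` be computed by a `Σ^kΠΣ` formula. Then `F ∘ G^{RC}_{n,R(k,d)} ≢ 0`").
Rendering: with `r = c·k²(⌊log₂ d⌋+1) + 1` as in `FSV2018_fact19` (print writes `R(k,d)` for the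
seed count, sloppy by one for the `+1` of Fact 19), `G^{RC}_{n,r}` is a hitting-set generator
(FSV Def. 7 (3)) for `Σ^kΠΣ` formulas of degree `d` in the `N = 2^n` coefficient variables, and its
outputs are coefficient vectors of read-once affine product sums with top fan-in `r` (size
`≤ r(2n+1) = poly(k, log d, n)`; Def. 7 (2)). Reduced to Fact 19 below (`FSV2018_cor22_of_fact19`).
[cite: ForbesShpilkaVolk2018, Cor. 22 with Lemmas 20–21 (seq.) = ToC Cor. 4.7, Lemmas 4.5–4.6, p. 22]
locator: paper:arxiv-1701.05328 p0016.txt:L78; paper:doi-10-4086-toc-2018-v014a018 p0022.txt:L19 -/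
def FSV2018_cor22 : Prop :=
  ∃ c : ℕ, ∀ (F : Type) [Field F] (n k d : ℕ),
    IsHittingSetGenerator (spskClass F (multilinearMonomials n) k d)
        (fun m : multilinearMonomials n =>
          rcGenCoeff F n (c * k ^ 2 * (Nat.log 2 d + 1) + 1) (m : Fin n →₀ ℕ)) ∧
      IsSuccinctGenerator (multilinearMonomials n)
        (roProductSums F n (c * k ^ 2 * (Nat.log 2 d + 1) + 1))
        (fun m : multilinearMonomials n =>
          rcGenCoeff F n (c * k ^ 2 * (Nat.log 2 d + 1) + 1) (m : Fin n →₀ ℕ))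

/-- **Lemmas 20–21 ⟹ Cor. 22, PROVED modulo Fact 19:** the succinct rank condenser inherits the
hitting property of the Vandermonde map by Prop. 17 (`isHittingSetGenerator_rcGenCoeff_of_vdm`) and
is succinct by construction (`isSuccinctGenerator_rcGenCoeff`).
[cite: ForbesShpilkaVolk2018, Cor. 22 (seq.) = ToC Cor. 4.7, p. 22]
locator: paper:doi-10-4086-toc-2018-v014a018 p0022.txt:L11 -/
theorem FSV2018_cor22_of_fact19 (h : FSV2018_fact19) : FSV2018_cor22 := by
  obtain ⟨c, hc⟩ := h
  refine ⟨c, fun F _ n k d => ⟨?_, isSuccinctGenerator_rcGenCoeff _⟩⟩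
  exact isHittingSetGenerator_rcGenCoeff_of_vdm _ (hc F n k d)

/-! ### §4.2 Depth-3 circuits of bounded transcendence degree -/

section Trdeg

variable (F : Type*) [CommRing F]

/-- **Transcendence degree at most `r`** of a family of polynomials (§4.2: "the transcendence
degree of this set, denoted `trdeg{F_1, …, F_ℓ}`, is the size of a maximal algebraically
independent subset"): every algebraically independent subfamily (Mathlib `AlgebraicIndependent`)
has at most `r` members. [cite: ForbesShpilkaVolk2018, §4.2 (seq. p. 17) = ToC §4.2, p. 22]
locator: paper:arxiv-1701.05328 p0017.txt:L1; paper:doi-10-4086-toc-2018-v014a018 p0022.txt:L25 -/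
def TrdegLE {ι κ : Type*} (T : κ → MvPolynomial ι F) (r : ℕ) : Prop :=
  ∀ S : Finset κ, AlgebraicIndependent F (fun i : S => T (i : κ)) → S.card ≤ r

/-- **The class of §4.2 / Lemma 23:** polynomials "expressible as `C(T_1, …, T_M)`, where the
`T_i`'s are products of linear functions and `trdeg{T_1, …, T_M} ≤ k`" (Thm. 24: "each `T_i` is a
product of `d` linear functions", `C` an arbitrary polynomial — print's "`C` being a `poly(N)`
degree circuit" constrains only the running time, not the generator property, and is vacuous for a
single `F`). Linear function = total degree `≤ 1`. [cite: ForbesShpilkaVolk2018, Lemma 23 and Thm. 24 (seq.) = ToC Lemma 4.8 and Thm. 4.9, pp. 22–23]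
locator: paper:arxiv-1701.05328 p0017.txt:L5; paper:doi-10-4086-toc-2018-v014a018 p0022.txt:L33 -/
def trdegProductClass (ι : Type*) (k d : ℕ) : Set (MvPolynomial ι F) :=
  {f | ∃ (M : ℕ) (L : Fin M → Fin d → MvPolynomial ι F) (C' : MvPolynomial (Fin M) F),
    (∀ i j, (L i j).totalDegree ≤ 1) ∧ TrdegLE F (fun i => ∏ j, L i j) k ∧
    f = aeval (fun i => ∏ j, L i j) C'}

/-- **The map `Ψ` of Lemma 23 [ASSS16]:** `X_i ↦ ∑_{j=1}^{k+1} z_j s^{ij} + ∑_{j=1}^{k} y_j t^{ij}`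
(two Vandermonde blocks with formal `s`, `t`), coordinate `i = binIndex m`; seed variables
`(z, s) = Sum.inl`, `(y, t) = Sum.inr`. [cite: ForbesShpilkaVolk2018, Lemma 23 (seq.) = ToC Lemma 4.8, p. 22]
locator: paper:arxiv-1701.05328 p0017.txt:L5; paper:doi-10-4086-toc-2018-v014a018 p0022.txt:L33 -/
def asssPsiGenCoeff (n k : ℕ) (m : Fin n →₀ ℕ) :
    MvPolynomial ((Fin (k + 1) ⊕ Unit) ⊕ (Fin k ⊕ Unit)) F :=
  rename Sum.inl (vdmGenCoeff F n (k + 1) m) + rename Sum.inr (vdmGenCoeff F n k m)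

/-- **The generator of Thm. 24** (its proof: "`Ψ` … can be represented as `coeff_x(P(y,z,s,t))`,
where `P(x,y,z,s,t) = P^{RC}_{n,k+1}(x,z,s) + P^{RC}_{n,k}(x,y,t)`"): the coordinate-wise sum of two
succinct rank condensers on disjoint seed blocks. [cite: ForbesShpilkaVolk2018, Thm. 24 (seq.) = ToC Thm. 4.9, p. 23 (proof)]
locator: paper:arxiv-1701.05328 p0017.txt:L15; paper:doi-10-4086-toc-2018-v014a018 p0023.txt:L2 -/
def trdegGenCoeff (n k : ℕ) (m : Fin n →₀ ℕ) :
    MvPolynomial ((Fin (k + 1) ⊕ Fin (n + 1)) ⊕ (Fin k ⊕ Fin (n + 1))) F :=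
  rename Sum.inl (rcGenCoeff F n (k + 1) m) + rename Sum.inr (rcGenCoeff F n k m)

variable {F} {n : ℕ}

/-- Outputs of a coordinate-wise sum of two maps on disjoint seed blocks are sums of outputs.
[folklore] -/
private theorem eval_rename_inl_add_rename_inr {τ₁ τ₂ : Type*} (p : MvPolynomial τ₁ F)
    (q : MvPolynomial τ₂ F) (a : τ₁ ⊕ τ₂ → F) :
    eval a (rename Sum.inl p + rename Sum.inr q) = eval (a ∘ Sum.inl) p + eval (a ∘ Sum.inr) q := by
  rw [map_add, eval_rename, eval_rename]

/-- **Succinctness half of Thm. 24 (PROVED):** every output of the generator `trdegGenCoeff n k`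
is the coefficient vector of a read-once affine product sum with top fan-in `(k+1) + k` ("The
succinctness follows from Prop. 18, and from observing that `poly(k,n)`-`ΣΠΣ` circuits are closed
under addition"). [cite: ForbesShpilkaVolk2018, Thm. 24 (seq.) = ToC Thm. 4.9, p. 23]
locator: paper:doi-10-4086-toc-2018-v014a018 p0023.txt:L2 -/
theorem isSuccinctGenerator_trdegGenCoeff (k : ℕ) :
    IsSuccinctGenerator (multilinearMonomials n) (roProductSums F n ((k + 1) + k))
      (fun m : multilinearMonomials n => trdegGenCoeff F n k (m : Fin n →₀ ℕ)) := by
  intro a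
  obtain ⟨f₁, hf₁, hf₁a⟩ := isSuccinctGenerator_rcGenCoeff (F := F) (n := n) (k + 1) (a ∘ Sum.inl)
  obtain ⟨f₂, hf₂, hf₂a⟩ := isSuccinctGenerator_rcGenCoeff (F := F) (n := n) k (a ∘ Sum.inr)
  refine ⟨f₁ + f₂, add_mem_roProductSums hf₁ hf₂, ?_⟩
  funext m
  have h1 := congrFun hf₁a m
  have h2 := congrFun hf₂a m
  simp only [coeffVector_apply, genOutput_apply] at h1 h2 ⊢
  rw [coeff_add, h1, h2, trdegGenCoeff, eval_rename_inl_add_rename_inr]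

/-- Prop. 17 on both blocks: the binary-powers substitution turns the generator of Thm. 24 into
the map `Ψ` of Lemma 23. [cite: ForbesShpilkaVolk2018, Thm. 24 (seq.) = ToC Thm. 4.9, p. 23 (proof)]
locator: paper:doi-10-4086-toc-2018-v014a018 p0023.txt:L2 -/
theorem bind₁_trdegGenCoeff (k : ℕ) (m : Fin n →₀ ℕ) :
    bind₁ (Sum.elim (fun v => rename Sum.inl (binaryPowersSubst F n (k + 1) v))
        (fun v => rename Sum.inr (binaryPowersSubst F n k v))) (trdegGenCoeff F n k m) =
      asssPsiGenCoeff F n k m := by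
  rw [trdegGenCoeff, asssPsiGenCoeff, map_add, bind₁_rename, bind₁_rename]
  have h1 : (Sum.elim (fun v => rename Sum.inl (binaryPowersSubst F n (k + 1) v))
      (fun v => rename Sum.inr (binaryPowersSubst F n k v))) ∘ Sum.inl =
      fun v => rename (Sum.inl : _ → (Fin (k + 1) ⊕ Unit) ⊕ (Fin k ⊕ Unit)) (binaryPowersSubst F n (k + 1) v) := rfl
  have h2 : (Sum.elim (fun v => rename Sum.inl (binaryPowersSubst F n (k + 1) v))
      (fun v => rename Sum.inr (binaryPowersSubst F n k v))) ∘ Sum.inr =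
      fun v => rename (Sum.inr : _ → (Fin (k + 1) ⊕ Unit) ⊕ (Fin k ⊕ Unit)) (binaryPowersSubst F n k v) := rfl
  rw [h1, h2, ← rename_bind₁, ← rename_bind₁, bind₁_binaryPowersSubst_rcGenCoeff,
    bind₁_binaryPowersSubst_rcGenCoeff]

/-- **Hitting half of Thm. 24, PROVED modulo Lemma 23:** a class hit by `Ψ` is hit by the
generator `trdegGenCoeff n k` (a specialisation of `D ∘ G` is `D ∘ Ψ ≠ 0`).
[cite: ForbesShpilkaVolk2018, Thm. 24 (seq.) = ToC Thm. 4.9, p. 23]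
locator: paper:doi-10-4086-toc-2018-v014a018 p0023.txt:L2 -/
theorem isHittingSetGenerator_trdegGenCoeff_of_psi (k : ℕ)
    {𝒟 : Set (MvPolynomial (multilinearMonomials n) F)}
    (h : IsHittingSetGenerator 𝒟 (fun m : multilinearMonomials n => asssPsiGenCoeff F n k (m : Fin n →₀ ℕ))) :
    IsHittingSetGenerator 𝒟 (fun m : multilinearMonomials n => trdegGenCoeff F n k (m : Fin n →₀ ℕ)) := by
  intro D hD hD0 hcomp
  refine h D hD hD0 ?_
  have := congrArg (bind₁ (Sum.elim (fun v => rename Sum.inl (binaryPowersSubst F n (k + 1) v))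
    (fun v => rename Sum.inr (binaryPowersSubst F n k v)))) hcomp
  rw [bind₁_bind₁, map_zero] at this
  simp_rw [bind₁_trdegGenCoeff] at this
  exact this

end Trdeg

/-- **FSV Lemma 23 (ToC Lemma 4.8) [Agrawal–Saha–Saptharishi–Saxena 2016; Chapter 4 of
Saptharishi's survey] — NAMED FACT.** Printed: "Suppose `𝔽` is a field such that `char(𝔽) = 0`
or `char(𝔽) ≥ d^k`. Then the map `Ψ : 𝔽[X] → 𝔽[y_1,…,y_k,t,z_1,…,z_{k+1},s]`, given by
`X_i ↦ ∑_{j=1}^{k+1} z_j s^{ij} + ∑_{j=1}^{k} y_j t^{ij}` for every `i ∈ [N]`, is a generator for the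
class of polynomials `F ∈ 𝔽[X]` expressible as `C(T_1, …, T_M)`, where the `T_i`'s are products of
linear functions and `trdeg{T_1, …, T_m} ≤ k`." (printed with `z_1, …, z_k` in the target ring and
`z_{k+1}` in the sum; the `k+1` block is meant). Rendering: `N = 2^n`, `i = binIndex m`; the class
`trdegProductClass F _ k d` (each `T_i` a product of `d` linear functions, as in Thm. 24, whose
characteristic condition refers to this `d`); generator = FSV Def. 7 (3). ERRATUM (val-lit t21,
2026-08-26, on the same hypothesis in Fact 51 / Lemma 52): the printed "`char(𝔽) ≥ d^k`" is typed
STRICT, `char(𝔽) > d^k` — the Jacobian criterion of [BMS13] behind [ASSS16] needs `char > d^r`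
(`𝔽_p`, `T = X^p`: `d^r = p = char`, Jacobian rank `0 ≠ trdeg 1`); the strict form is the weaker,
safe reading of the fact. [cite: ForbesShpilkaVolk2018, Lemma 23 (seq.) = ToC Lemma 4.8, p. 22]
locator: paper:arxiv-1701.05328 p0017.txt:L5; paper:doi-10-4086-toc-2018-v014a018 p0022.txt:L33 -/
def FSV2018_lemma23 : Prop :=
  ∀ (F : Type) [Field F] (n k d : ℕ), (ringChar F = 0 ∨ d ^ k < ringChar F) →
    IsHittingSetGenerator (trdegProductClass F (multilinearMonomials n) k d)
      (fun m : multilinearMonomials n => asssPsiGenCoeff F n k (m : Fin n →₀ ℕ))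

/-- **FSV Thm. 24 (ToC Thm. 4.9) — NAMED FACT (existence form as printed).** "Suppose `𝔽` is a
field such that `char(𝔽) = 0` or `char(𝔽) ≥ d^k`. Then there exists a `poly(k,n)`-`ΣΠΣ` succinct
generator for the class of polynomials that can be represented as `C(T_1, …, T_M)` with `C` being
a `poly(N)` degree circuit, each `T_i` is a product of `d` linear functions and
`trdeg{T_1, …, T_M} ≤ k`." Rendering: some polynomial map on a finite seed type that is a
hitting-set generator for `trdegProductClass F _ k d` (`N = 2^n` coefficient variables of the
multilinear space) and whose outputs are coefficient vectors of read-once affine product sums of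
top fan-in `≤ (k+2)^c` (size `poly(k,n)`), one uniform exponent `c`. The witness in print is
`trdegGenCoeff n k` (top fan-in `2k+1`); reduced to Lemma 23 below. Characteristic hypothesis typed
STRICT (`char > d^k`), see the erratum note at `FSV2018_lemma23`.
[cite: ForbesShpilkaVolk2018, Thm. 24 (seq.) = ToC Thm. 4.9, p. 23]
locator: paper:arxiv-1701.05328 p0017.txt:L15; paper:doi-10-4086-toc-2018-v014a018 p0023.txt:L2 -/
def FSV2018_thm24 : Prop :=
  ∃ c : ℕ, ∀ (F : Type) [Field F] (n k d : ℕ), (ringChar F = 0 ∨ d ^ k < ringChar F) →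
    ∃ (τ : Type) (_ : Fintype τ) (G : multilinearMonomials n → MvPolynomial τ F),
      IsHittingSetGenerator (trdegProductClass F (multilinearMonomials n) k d) G ∧
        IsSuccinctGenerator (multilinearMonomials n) (roProductSums F n ((k + 2) ^ c)) G

/-- **Thm. 24 PROVED modulo Lemma 23** (print: "Observe that `Ψ` from Lemma 23 can be represented
as `coeff_x(P…)` … The succinctness follows from Prop. 18"): witness `trdegGenCoeff n k`, exponent
`c = 2` (`2k+1 ≤ (k+2)²`). [cite: ForbesShpilkaVolk2018, Thm. 24 (seq.) = ToC Thm. 4.9, p. 23]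
locator: paper:doi-10-4086-toc-2018-v014a018 p0023.txt:L2 -/
theorem FSV2018_thm24_of_lemma23 (h : FSV2018_lemma23) : FSV2018_thm24 := by
  refine ⟨2, fun F _ n k d hchar => ?_⟩
  refine ⟨(Fin (k + 1) ⊕ Fin (n + 1)) ⊕ (Fin k ⊕ Fin (n + 1)), inferInstance,
    fun m => trdegGenCoeff F n k (m : Fin n →₀ ℕ),
    isHittingSetGenerator_trdegGenCoeff_of_psi k (h F n k d hchar), ?_⟩
  refine (isSuccinctGenerator_trdegGenCoeff (F := F) (n := n) k).mono (roProductSums_mono ?_)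
  nlinarith


/-! ## §5 Succinct hitting sets via the Shpilka–Volkovich generator

Construction 25 (`Q^{SSV}`, `G^{SSV}`), Construction 29 (the shift by `𝟙`) and the coefficient
identity of Lemma 28's setting are the tree's `svGenCoeff` / `svPoly` /
`coeff_svPoly_eq_eval_svGenCoeff` (`SuccinctSVGenerator.lean`, the SHIFTED generator
`G^{SSSV} = G^{SSV} + 𝟙`); Cor. 34 in generator form is the tree's named fact
`ForbesShpilkaVolk2018_svGeneratorHitsSparse`. Typed here: the UNSHIFTED `G^{SSV}` (needed by
§5.3 and by the additivity Fact 27), Facts 26 / 27 / 30 (proved), Lemmas 28, 31, 32, 33 (facts;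
33 with its erratum), and the succinctness half of Cor. 34 (proved). -/

section SV

variable (F : Type*) [CommRing F] {n : ℕ}

/-- **FSV Construction 25 (ToC 5.1), the UNSHIFTED succinct SV generator `G^{SSV}_{n,k}` as a
polynomial map.** Printed: "`P(z, x) = ∏_{i=1}^n (z_i x_i + (1 - z_i))`,
`Q^{SSV}_{n,k}(y, z, x) = ∑_{i ∈ [k]} y_i · P(z_i, x)`, `G^{SSV}_{n,k}(y, z) = coeff_x(Q^{SSV}_{n,k})`."
Coordinate at `x^m` (`S = supp m`): `∑_j y_j ∏_{i ∈ S} z_{j,i} ∏_{i ∉ S} (1 - z_{j,i})`; seed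
variables as in the tree's `svGenCoeff` (`y_j = Sum.inl j`, `z_{j,i} = Sum.inr (j,i)`), of which this
is the summand before the shift `+ 1` (`svGenCoeff_eq_ssvGenCoeff_add_one`).
[cite: ForbesShpilkaVolk2018, Construction 25 (seq.) = ToC Construction 5.1, p. 23]
locator: paper:arxiv-1701.05328 p0018.txt:L5; paper:doi-10-4086-toc-2018-v014a018 p0023.txt:L19 -/
def ssvGenCoeff (n k : ℕ) (m : Fin n →₀ ℕ) : MvPolynomial (Fin k ⊕ (Fin k × Fin n)) F :=
  ∑ j : Fin k, X (Sum.inl j) *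
    ∏ i : Fin n, (if m i = 0 then 1 - X (Sum.inr (j, i)) else X (Sum.inr (j, i)))

/-- **`Q^{SSV}_{n,k}(α, β, x)` at a seed:** `∑_j α_j ∏_i (β_{j,i} x_i + (1 - β_{j,i}))`, a read-once
affine product sum with top fan-in `k` (Fact 26). [cite: ForbesShpilkaVolk2018, Construction 25 and Fact 26 (seq.) = ToC 5.1–5.2, p. 23]
locator: paper:arxiv-1701.05328 p0018.txt:L21; paper:doi-10-4086-toc-2018-v014a018 p0023.txt:L35 -/
def ssvPoly (n k : ℕ) (α : Fin k → F) (β : Fin k → Fin n → F) : MvPolynomial (Fin n) F :=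
  affineProductSum F n k α β (fun j i => 1 - β j i)

variable {F}

/-- **FSV Fact 30 (ToC 5.6), PROVED (definitionally):** `G^{SSSV}_{n,k} = G^{SSV}_{n,k} + 𝟙`
("as polynomial maps, we have the equality `G^{SSSV}_{n,k}(y,z) = G^{SSV}_{n,k} + 1`"); the tree's
`svGenCoeff` is the shifted generator. [cite: ForbesShpilkaVolk2018, Fact 30 (seq.) = ToC Fact 5.6, p. 25]
locator: paper:arxiv-1701.05328 p0018.txt:L80; paper:doi-10-4086-toc-2018-v014a018 p0025.txt:L18 -/
theorem svGenCoeff_eq_ssvGenCoeff_add_one (k : ℕ) (m : Fin n →₀ ℕ) :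
    svGenCoeff F n k m = ssvGenCoeff F n k m + 1 := rfl

/-- **Construction 29 (ToC 5.5) at a seed, PROVED (definitionally):**
`Q^{SSSV}_{n,k} = Q^{SSV}_{n,k} + ∏_i (x_i + 1)` — the tree's `svPoly` is `ssvPoly` plus the shift.
[cite: ForbesShpilkaVolk2018, Construction 29 (seq.) = ToC Construction 5.5, p. 25]
locator: paper:arxiv-1701.05328 p0018.txt:L68; paper:doi-10-4086-toc-2018-v014a018 p0025.txt:L2 -/
theorem svPoly_eq_ssvPoly_add (k : ℕ) (α : Fin k → F) (β : Fin k → Fin n → F) :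
    svPoly F n k α β = ssvPoly F n k α β + ∏ i : Fin n, (X i + 1) := rfl

/-- The unshifted generator's output at a seed:
`G^{SSV}_{n,k}(α,β)_m = ∑_j α_j ∏_{i ∈ supp m} β_{j,i} ∏_{i ∉ supp m} (1 - β_{j,i})`.
[cite: ForbesShpilkaVolk2018, Construction 25 (seq.) = ToC Construction 5.1, p. 23] -/
theorem eval_ssvGenCoeff (k : ℕ) (α : Fin k → F) (β : Fin k → Fin n → F) (m : Fin n →₀ ℕ) :
    eval (Sum.elim α fun p : Fin k × Fin n => β p.1 p.2) (ssvGenCoeff F n k m) =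
      ∑ j : Fin k, α j * ((∏ i ∈ m.support, β j i) * ∏ i ∈ m.supportᶜ, (1 - β j i)) := by
  have h := eval_svGenCoeff n k α β m
  rw [svGenCoeff_eq_ssvGenCoeff_add_one, map_add, map_one] at h
  exact add_right_cancel h

/-- `coeff_x(Q^{SSV}) = G^{SSV}` at every seed (PROVED). [cite: ForbesShpilkaVolk2018, Construction 25 (seq.) = ToC Construction 5.1, p. 23]
locator: paper:doi-10-4086-toc-2018-v014a018 p0023.txt:L19 -/
theorem coeff_ssvPoly_eq_eval_ssvGenCoeff (k : ℕ) (α : Fin k → F) (β : Fin k → Fin n → F)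
    {m : Fin n →₀ ℕ} (hm : m ∈ multilinearMonomials n) :
    coeff m (ssvPoly F n k α β) = eval (Sum.elim α fun p : Fin k × Fin n => β p.1 p.2) (ssvGenCoeff F n k m) := by
  rw [ssvPoly, coeff_affineProductSum, if_pos hm, eval_ssvGenCoeff]

/-- **FSV Fact 26 (ToC 5.2), succinctness, PROVED:** "For every setting `y = α`, `z = β`, the
polynomial `Q^{SSV}_{n,k}` is computed by a multilinear `ΣΠΣ` circuit of size `poly(n,k)`" — it is
a read-once affine product sum with top fan-in `k` (complexity `≤ k(3n+2)` by
`complexity_affineProductSum_le`). [cite: ForbesShpilkaVolk2018, Fact 26 (seq.) = ToC Fact 5.2, p. 23]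
locator: paper:arxiv-1701.05328 p0018.txt:L21; paper:doi-10-4086-toc-2018-v014a018 p0023.txt:L35 -/
theorem ssvPoly_mem_roProductSums (k : ℕ) (α : Fin k → F) (β : Fin k → Fin n → F) :
    ssvPoly F n k α β ∈ roProductSums F n k :=
  ⟨_, _, _, rfl⟩

/-- The shift `∏_i (x_i + 1)` of Construction 29 is a read-once affine product (top fan-in `1`;
"`coeff(∏_{i=1}^n (x_i + 1)) = 𝟙`"). [cite: ForbesShpilkaVolk2018, Construction 29 and Fact 30 (seq.) = ToC 5.5–5.6, p. 25] -/
theorem prod_X_add_one_mem_roProductSums :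
    (∏ i : Fin n, (X i + 1) : MvPolynomial (Fin n) F) ∈ roProductSums F n 1 :=
  ⟨fun _ => 1, fun _ _ => 1, fun _ _ => 1, by simp [affineProductSum]⟩

/-- **Fact 30, succinctness, PROVED:** `Q^{SSSV}_{n,k}(α,β,x)` (the tree's `svPoly`) is a read-once
affine product sum with top fan-in `k + 1` ("The generator `G^{SSSV}_{n,k}` is `poly(k,n)`-`ΣΠΣ`
succinct"). [cite: ForbesShpilkaVolk2018, Fact 30 (seq.) = ToC Fact 5.6, p. 25]
locator: paper:arxiv-1701.05328 p0018.txt:L80; paper:doi-10-4086-toc-2018-v014a018 p0025.txt:L18 -/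
theorem svPoly_mem_roProductSums (k : ℕ) (α : Fin k → F) (β : Fin k → Fin n → F) :
    svPoly F n k α β ∈ roProductSums F n (k + 1) := by
  rw [svPoly_eq_ssvPoly_add]
  exact add_mem_roProductSums (ssvPoly_mem_roProductSums k α β) prod_X_add_one_mem_roProductSums

/-- `G^{SSV}_{n,k}` is `roProductSums n k`-succinct (FSV Def. 7 (2) for Fact 26), PROVED.
[cite: ForbesShpilkaVolk2018, Fact 26 (seq.) = ToC Fact 5.2, p. 23]
locator: paper:doi-10-4086-toc-2018-v014a018 p0023.txt:L35 -/
theorem isSuccinctGenerator_ssvGenCoeff (k : ℕ) :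
    IsSuccinctGenerator (multilinearMonomials n) (roProductSums F n k)
      (fun m : multilinearMonomials n => ssvGenCoeff F n k (m : Fin n →₀ ℕ)) := by
  intro a
  refine ⟨ssvPoly F n k (fun j => a (Sum.inl j)) (fun j i => a (Sum.inr (j, i))),
    ssvPoly_mem_roProductSums _ _ _, ?_⟩
  have ha : (Sum.elim (fun j => a (Sum.inl j)) fun p : Fin k × Fin n => a (Sum.inr (p.1, p.2))) = a := by
    funext v; rcases v with j | ⟨j, i⟩ <;> rfl
  funext m
  rw [coeffVector_apply, genOutput_apply, coeff_ssvPoly_eq_eval_ssvGenCoeff _ _ _ m.2, ha]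

/-- **Succinctness half of Cor. 34 / Fact 30, PROVED:** the shifted generator `G^{SSSV}_{n,k}`
(tree: `svGenCoeff`) is `roProductSums n (k+1)`-succinct — its outputs are the coefficient vectors
of the `svPoly`'s. [cite: ForbesShpilkaVolk2018, Fact 30 and Cor. 34 (seq.) = ToC Fact 5.6 and Cor. 5.10, pp. 25–26]
locator: paper:arxiv-1701.05328 p0019.txt:L49; paper:doi-10-4086-toc-2018-v014a018 p0026.txt:L27 -/
theorem isSuccinctGenerator_svGenCoeff (k : ℕ) :
    IsSuccinctGenerator (multilinearMonomials n) (roProductSums F n (k + 1))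
      (fun m : multilinearMonomials n => svGenCoeff F n k (m : Fin n →₀ ℕ)) := by
  intro a
  refine ⟨svPoly F n k (fun j => a (Sum.inl j)) (fun j i => a (Sum.inr (j, i))),
    svPoly_mem_roProductSums _ _ _, ?_⟩
  have ha : (Sum.elim (fun j => a (Sum.inl j)) fun p : Fin k × Fin n => a (Sum.inr (p.1, p.2))) = a := by
    funext v; rcases v with j | ⟨j, i⟩ <;> rfl
  funext m
  rw [coeffVector_apply, genOutput_apply, coeff_svPoly_eq_eval_svGenCoeff _ _ _ _ m.2, ha]

/-- The embedding of the first seed block `(y₁, z₁)` of `G^{SSV}_{n,k₁}` into the seeds of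
`G^{SSV}_{n,k₁+k₂}` (Fact 27: `y' = (y₁, y₂)`, `z' = (z₁, z₂)`). [cite: ForbesShpilkaVolk2018, Fact 27 (seq.) = ToC Fact 5.3, p. 23] -/
def svSeedInl (n k₁ k₂ : ℕ) : Fin k₁ ⊕ (Fin k₁ × Fin n) → Fin (k₁ + k₂) ⊕ (Fin (k₁ + k₂) × Fin n) :=
  Sum.map (Fin.castAdd k₂) (Prod.map (Fin.castAdd k₂) id)

/-- The embedding of the second seed block `(y₂, z₂)`. [cite: ForbesShpilkaVolk2018, Fact 27 (seq.) = ToC Fact 5.3, p. 23] -/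
def svSeedInr (n k₁ k₂ : ℕ) : Fin k₂ ⊕ (Fin k₂ × Fin n) → Fin (k₁ + k₂) ⊕ (Fin (k₁ + k₂) × Fin n) :=
  Sum.map (Fin.natAdd k₁) (Prod.map (Fin.natAdd k₁) id)

/-- Renaming one factor of the SV product. [folklore] -/
private theorem rename_svFactor {τ τ' : Type*} (e : τ → τ') (c : Prop) [Decidable c] (v : τ) :
    rename e (if c then 1 - X v else X v : MvPolynomial τ F) = if c then 1 - X (e v) else X (e v) := by
  split_ifs <;> simp

/-- **FSV Fact 27 (ToC 5.3), additivity, PROVED:** "the succinct SV-generator is additive in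
`y, z`": `G^{SSV}_{n,k₁}(y₁,z₁) + G^{SSV}_{n,k₂}(y₂,z₂) = G^{SSV}_{n,k₁+k₂}(y',z')` with
`y' = (y₁,y₂)`, `z' = (z₁,z₂)`, as polynomial maps (coordinate-wise, the blocks embedded by
`svSeedInl` / `svSeedInr`). [cite: ForbesShpilkaVolk2018, Fact 27 (seq.) = ToC Fact 5.3, p. 23]
locator: paper:arxiv-1701.05328 p0018.txt:L25; paper:doi-10-4086-toc-2018-v014a018 p0023.txt:L38 -/
theorem ssvGenCoeff_add (k₁ k₂ : ℕ) (m : Fin n →₀ ℕ) :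
    ssvGenCoeff F n (k₁ + k₂) m =
      rename (svSeedInl n k₁ k₂) (ssvGenCoeff F n k₁ m) + rename (svSeedInr n k₁ k₂) (ssvGenCoeff F n k₂ m) := by
  rw [ssvGenCoeff, ssvGenCoeff, ssvGenCoeff, Fin.sum_univ_add, map_sum, map_sum]
  congr 1
  · refine Finset.sum_congr rfl fun j _ => ?_
    rw [map_mul, rename_X, map_prod]
    simp_rw [rename_svFactor]
    rfl
  · refine Finset.sum_congr rfl fun j _ => ?_
    rw [map_mul, rename_X, map_prod]
    simp_rw [rename_svFactor]
    rfl

end SV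

/-- **FSV Lemma 28 (ToC Lemma 5.4), the `k`-wise independence property of `G^{SSV}` — NAMED FACT.**
Printed: "For every `T ⊆ [N]` such that `|T| ≤ k`, there is a fixing of the `z` variables, and
possibly of some of the `y` variables, such that in the mapping `G^{SSV}_{n,k}`, `|T|` distinct `y`
variables are planted in the coordinates corresponding to `T`, while the rest of the entries are
zeroed out." PROVED below (`FSV2018_lemma28_holds`). Rendering: `T` a set of at most `k` multilinear monomials (= coordinates); a
substitution fixing every `z_{j,i}` to a constant `β_{j,i}` and each `y_j` either to itself or to
`0`; an injective assignment `e` of seed indices to the members of `T` ("`|T|` distinct `y`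
variables"); after the substitution the coordinate `m` of `G^{SSV}_{n,k}` is the variable `y_{e(m)}`
for `m ∈ T` and `0` otherwise. (Proof as in print: `z_j = 𝟙_{S_j}`.)
[cite: ForbesShpilkaVolk2018, Lemma 28 (seq.) = ToC Lemma 5.4, p. 24]
locator: paper:arxiv-1701.05328 p0018.txt:L38; paper:doi-10-4086-toc-2018-v014a018 p0024.txt:L4 -/
def FSV2018_lemma28 : Prop :=
  ∀ (F : Type) [Field F] (n k : ℕ) (T : Finset (multilinearMonomials n)), T.card ≤ k →
    ∃ (β : Fin k × Fin n → F) (keep : Fin k → Bool) (e : T → Fin k),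
      Function.Injective e ∧
      ∀ m : multilinearMonomials n,
        bind₁ (Sum.elim (fun j => if keep j then X j else 0) (fun p => C (β p)))
            (ssvGenCoeff F n k (m : Fin n →₀ ℕ)) =
          if h : m ∈ T then X (e ⟨m, h⟩) else 0

/-- **FSV Lemma 31 (ToC Lemma 5.7) — NAMED FACT.** Printed: "Let `𝒞` be a class such that for all
`F ∈ 𝒞`, `F(X + 1)` contains a monomial of support at most `k`. Then if `F ≢ 0`,
`F ∘ G^{SSSV}_{n,k}(y,z) ≢ 0`." Rendering (per polynomial; the class is a device): for a nonzero
`D` in the `N = 2^n` coefficient variables whose shift `D(X + 𝟙)` has a monomial with at most `k`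
variables, the composition with the shifted generator (tree: `svGenCoeff`) is a nonzero polynomial in
the seeds. PROVED below from Lemma 28 (`FSV2018_lemma31_holds`).
[cite: ForbesShpilkaVolk2018, Lemma 31 (seq.) = ToC Lemma 5.7, p. 25]
locator: paper:arxiv-1701.05328 p0019.txt:L8; paper:doi-10-4086-toc-2018-v014a018 p0025.txt:L25 -/
def FSV2018_lemma31 : Prop :=
  ∀ (F : Type) [Field F] (n k : ℕ) (D : MvPolynomial (multilinearMonomials n) F), D ≠ 0 →
    (∃ m ∈ (aeval (fun v : multilinearMonomials n => (X v + 1 : MvPolynomial (multilinearMonomials n) F)) D).support,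
      m.support.card ≤ k) →
    bind₁ (fun m : multilinearMonomials n => svGenCoeff F n k (m : Fin n →₀ ℕ)) D ≠ 0

/-- **FSV Lemma 32 (ToC Lemma 5.8) [Forbes 2015; Gurjar–Korwar–Saxena–Thierauf 2016] — NAMED
FACT.** Printed: "Let `F ∈ 𝔽[X_1, …, X_N]` be a polynomial with at most `s` monomials, and
`α ∈ 𝔽^N` be a full support vector, that is, for all `i ∈ [N]`, `α_i ≠ 0`. Then the polynomial
`F(X + α)` has a monomial of support at most `log s`." Rendering: `F ≠ 0` (implicit in print — the
zero polynomial has no monomial), any variable type, `log s = ⌊log₂ s⌋` (the printed proof gives a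
monomial `m` with `2^{|supp m|} ≤ s`). Proved ROUTE-SIDE over `ℂ` in the regime `d = n`
(`…BarrierLever.SuccinctHittingSetsForVP.ShiftSmallSupport.exists_narrow_monomial`, not importable
here). [cite: ForbesShpilkaVolk2018, Lemma 32 (seq.) = ToC Lemma 5.8, p. 25]
locator: paper:arxiv-1701.05328 p0019.txt:L24; paper:doi-10-4086-toc-2018-v014a018 p0025.txt:L53 -/
def FSV2018_lemma32 : Prop :=
  ∀ (F : Type) [Field F] (ι : Type) (P : MvPolynomial ι F) (s : ℕ), P ≠ 0 → P.support.card ≤ s →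
    ∀ α : ι → F, (∀ i, α i ≠ 0) →
      ∃ m ∈ (aeval (fun i => (X i + C (α i) : MvPolynomial ι F)) P).support,
        m.support.card ≤ Nat.log 2 s

/-- **FSV Lemma 33 (ToC Lemma 5.9) [Oliveira; Forbes–Saptharishi–Tse–Wigderson 2016, Prop. 6.14]
— NAMED FACT, CORRECTED.** Printed (both versions): "Let `F ∈ 𝔽[X_1, …, X_N]` be a multilinear
polynomial with at most `s` monomials, and `G ∈ 𝔽[X_1, …, X_N]` be any non-zero polynomial. Then
`F · G` has at most `s` monomials." ERRATUM: as printed this is false (`F = 1`, `G = X_1 + X_2`);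
the statement used in the proof of Lemma 32 ("`∏_{i=1}^ℓ (X_i - α_i)` is multilinear of sparsity
`2^ℓ > s`, it follows from Lemma 33 that the sparsity of `F(…)` is also greater than `s`") and
proved in [FSTW16, Prop. 6.14] is the LOWER bound: a multilinear `F` times a nonzero `G` has AT
LEAST as many monomials as `F`. Typed in that corrected form. Special case proved ROUTE-SIDE over
`ℂ` (`…SuccinctHittingSetsForVP.stub_prodSparsity`: `(∏_{i ∈ S} (X_i - a_i)) · H` has `≥ 2^{|S|}`
monomials); the general corrected statement is PROVED below (`FSV2018_lemma33_holds`).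
[cite: ForbesShpilkaVolk2018, Lemma 33 (seq.) = ToC Lemma 5.9, p. 26 (erratum: "at most" ↦ "at least")]
locator: paper:arxiv-1701.05328 p0019.txt:L30; paper:doi-10-4086-toc-2018-v014a018 p0026.txt:L5 -/
def FSV2018_lemma33 : Prop :=
  ∀ (F : Type) [Field F] (ι : Type) (P Q : MvPolynomial ι F),
    (∀ m ∈ P.support, ∀ i, m i ≤ 1) → Q ≠ 0 → P.support.card ≤ (P * Q).support.card

/-! ### §5.2 Sums of powers of low-degree polynomials (`Σm∧ΣΠ^t`) -/

section Smesp

variable (F : Type*) [CommRing F]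

/-- **FSV Def. 35 (ToC Def. 5.11), `Σm∧ΣΠ^t` formulas:** "`F(X) = ∑_{i=1}^s X^{a_i} F_i(X)^{d_i}`,
where `deg F_i ≤ t` for all `i ∈ [s]`, and `X^{a_i}` is a monomial" — the class with top fan-in `s`
and bottom degree `t`. [cite: ForbesShpilkaVolk2018, Def. 35 (seq.) = ToC Def. 5.11, p. 26]
locator: paper:arxiv-1701.05328 p0019.txt:L57; paper:doi-10-4086-toc-2018-v014a018 p0026.txt:L32 -/
def smespClass (ι : Type*) (s t : ℕ) : Set (MvPolynomial ι F) :=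
  {f | ∃ (a : Fin s → ι →₀ ℕ) (G : Fin s → MvPolynomial ι F) (d : Fin s → ℕ),
    (∀ i, (G i).totalDegree ≤ t) ∧ f = ∑ i, monomial (a i) 1 * G i ^ d i}

end Smesp

/-- **FSV Lemma 36 (ToC Lemma 5.12) [Forbes 2015] — NAMED FACT.** Printed: "Suppose `F[X]` is
computed by a `Σm∧ΣΠ^{O(1)}` formula of top fan-in `s`, and let `α` be a full-support vector. Then
it holds that `F(X + α)` has a monomial of support at most `O(log s)`." Rendering: for every bottom
degree `t` (the `O(1)`) a constant `c_t` with support bound `c_t · (⌊log₂ s⌋ + 1)`; `F ≠ 0`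
implicit in print. ERRATUM / provenance (D8, val-lit lead-np ruling (17), safe reading of the cited source):
FSV state this with NO characteristic hypothesis (arXiv p0019:L64–L68; ToC p. 26), "proved in
[Forbes15]"; but [Forbes15] Prop. 6.5 (paper:doi-10-1109-focs-2015-35 p0032:L87–L91: "If
char(F) > ideg x^a, then ‖a‖₀ ≤ 2e³(t+1)(ln s + m ln(2m) + 1)") and Cor. 6.7 (p0034:L1–L3: "Let F be
a field with char(F) > d") prove it only in characteristic `0` or `> deg`, the shifted-partials
method needing it (Rem. 4.16, p0022:L4–L14). The hypothesis
`ringChar F = 0 ∨ P.totalDegree < ringChar F` below is therefore inserted (typed WEAKER than FSV's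
print, equal to it in characteristic `0`, exactly what is proved); the case `0 < char F ≤ deg` is
unproved in print (no counterexample known). [cite: ForbesShpilkaVolk2018, Lemma 36 (seq.) = ToC Lemma 5.12, p. 26]
[cite: Forbes2015, Prop. 6.5 and Cor. 6.7 (characteristic hypothesis)]
locator: paper:arxiv-1701.05328 p0019.txt:L66; paper:doi-10-4086-toc-2018-v014a018 p0026.txt:L42 -/
def FSV2018_lemma36 : Prop :=
  ∀ t : ℕ, ∃ c : ℕ, ∀ (F : Type) [Field F] (ι : Type) (P : MvPolynomial ι F) (s : ℕ),
    P ∈ smespClass F ι s t → P ≠ 0 → (ringChar F = 0 ∨ P.totalDegree < ringChar F) →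
      ∀ α : ι → F, (∀ i, α i ≠ 0) →
      ∃ m ∈ (aeval (fun i => (X i + C (α i) : MvPolynomial ι F)) P).support,
        m.support.card ≤ c * (Nat.log 2 s + 1)

/-- **FSV Thm. 37 (ToC Thm. 5.13) — NAMED FACT (existence form as printed).** "There exists a
`poly(log s, n)`-`ΣΠΣ` succinct generator for the class of `Σm∧ΣΠ^{O(1)}` formulas of top fan-in
`s`." Rendering: for every bottom degree `t` a uniform exponent `c`; for all fields and all `n, s` a
polynomial map on a finite seed type that is a hitting-set generator for `Σm∧ΣΠ^t` formulas of top
fan-in `s` in the `N = 2^n` coefficient variables, with outputs the coefficient vectors of read-once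
affine product sums of top fan-in `≤ (⌊log₂ s⌋ + 2)^c` (size `poly(log s, n)`). Witness in print:
`G^{SSSV}_{n, C log s}` (Lemma 36 + Lemma 31 + Fact 30). ERRATUM / provenance (D8, safe reading,
val-lit lead-np ruling (17)): the hit class is restricted to the formulas `P` with
`ringChar F = 0 ∨ P.totalDegree < ringChar F`, the hypothesis under which the ingredient Lemma 36 is
proved in [Forbes15] (Prop. 6.5 p0032:L87–L91, Cor. 6.7 p0034:L1–L3, Rem. 4.16 p0022:L4–L14); FSV
print no characteristic hypothesis (arXiv p0019:L72; ToC p. 27). Equal to print in characteristic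
`0`; weaker otherwise.
[cite: ForbesShpilkaVolk2018, Thm. 37 (seq.) = ToC Thm. 5.13, p. 27]
[cite: Forbes2015, Cor. 6.7 (characteristic hypothesis)]
locator: paper:arxiv-1701.05328 p0019.txt:L72; paper:doi-10-4086-toc-2018-v014a018 p0027.txt:L2 -/
def FSV2018_thm37 : Prop :=
  ∀ t : ℕ, ∃ c : ℕ, ∀ (F : Type) [Field F] (n s : ℕ),
    ∃ (τ : Type) (_ : Fintype τ) (G : multilinearMonomials n → MvPolynomial τ F),
      IsHittingSetGenerator {P | P ∈ smespClass F (multilinearMonomials n) s t ∧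
          (ringChar F = 0 ∨ P.totalDegree < ringChar F)} G ∧
        IsSuccinctGenerator (multilinearMonomials n) (roProductSums F n ((Nat.log 2 s + 2) ^ c)) G

/-! ### §5.3 Commutative read-once oblivious algebraic branching programs -/

section ROABP

variable (F : Type*) [CommRing F]

/-- **Read-once oblivious ABPs (§5.3, matrix form).** Printed: "`F` is computed by a roABP in
variable order `σ` if there exist `N` matrices `M_1, …, M_N` of size `r × r` such that each entry in
`M_i` is a univariate, degree `d` polynomial in `X_{σ(i)}`, and `F = (∏_{i=1}^N M_i(X_{σ(i)}))_{1,1}`.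
… The width of the roABP is … `max_i |V_i|`" (here: the matrix size `w`). The order is a bijection
`π : Fin N ≃ ι` (layer `i` reads the variable `π i`); entries = univariate polynomials of degree
`≤ d` in that variable; `F` = the `(1,1)` entry of the ordered product.
[cite: ForbesShpilkaVolk2018, §5.3 (definition of roABP, seq. p. 19–20) = ToC §5.3, p. 27]
locator: paper:arxiv-1701.05328 p0019.txt:L79; paper:doi-10-4086-toc-2018-v014a018 p0027.txt:L9 -/
def IsROABP {ι : Type*} {N : ℕ} (w d : ℕ) (π : Fin N ≃ ι) (f : MvPolynomial ι F) : Prop :=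
  ∃ (hw : 0 < w) (M : Fin N → Matrix (Fin w) (Fin w) (MvPolynomial ι F)),
    (∀ i a b, ∃ p : Polynomial F, p.natDegree ≤ d ∧ M i a b = Polynomial.aeval (X (π i)) p) ∧
    f = (List.ofFn M).prod ⟨0, hw⟩ ⟨0, hw⟩

/-- **Commutative roABPs (§5.3):** "A polynomial `f ∈ 𝔽[X]` is computed by a width `w`
commutative roABP, if it is computable by a width `w` ABP in every variable order." (individual
degree `≤ d` of the edge labels carried along; `N` ranges over all sizes admitting a bijection
`Fin N ≃ ι`, i.e. `N = |ι|`). [cite: ForbesShpilkaVolk2018, §5.3 (seq. p. 20) = ToC §5.3, p. 27]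
locator: paper:arxiv-1701.05328 p0020.txt:L3; paper:doi-10-4086-toc-2018-v014a018 p0027.txt:L30 -/
def IsCommROABP {ι : Type*} (w d : ℕ) (f : MvPolynomial ι F) : Prop :=
  ∀ (N : ℕ) (π : Fin N ≃ ι), IsROABP F w d π f

/-- A MATRIX of polynomials computed by width-`w` roABPs in every variable order (the hypothesis
"`F ∈ 𝔽[X]^{w×w}` … computed by a commutative roABP of width `w`" of Lemma 40): for every order the
whole ordered product of the layer matrices is `F`.
[cite: ForbesShpilkaVolk2018, Lemma 40 (seq.) = ToC Lemma 5.16, p. 28]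
locator: paper:arxiv-1701.05328 p0020.txt:L26; paper:doi-10-4086-toc-2018-v014a018 p0028.txt:L18 -/
def IsCommROABPMatrix {ι : Type*} (w d : ℕ) (Fm : Matrix (Fin w) (Fin w) (MvPolynomial ι F)) : Prop :=
  ∀ (N : ℕ) (π : Fin N ≃ ι), ∃ M : Fin N → Matrix (Fin w) (Fin w) (MvPolynomial ι F),
    (∀ i a b, ∃ p : Polynomial F, p.natDegree ≤ d ∧ M i a b = Polynomial.aeval (X (π i)) p) ∧
    Fm = (List.ofFn M).prod

/-- **FSV Def. 38 (ToC Def. 5.14) [FSS14], `ℓ`-wise independent monomial map of individual degree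
`d`.** Printed: "Let `g : 𝔽^m × 𝔽^{m'} → 𝔽^N` be a polynomial map. `g` is said to be an individual
degree `d`, `ℓ`-wise independent monomial map if for every `S ⊆ [N]` of size at most `ℓ`, there is
`α ∈ 𝔽^{m'}` such that the polynomials `{g(t,α)^a : supp(a) ⊆ S, max_i a_i ≤ d}` are non-zero and
distinct monomials in `t`, where we define `g(t,α)^a = ∏_{i=1}^N (g(t,α)_i^{a_i})`." Rendering: `g`
has seed variables `τ ⊕ τ'` (`t = Sum.inl`, the block `α` fixes `= Sum.inr`); "non-zero and distinct
monomials": each `g(t,α)^a` is `monomial (expo a) c` with `c ≠ 0`, for an exponent assignment `expo`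
injective on the relevant `a`'s. [cite: ForbesShpilkaVolk2018, Def. 38 (seq.) = ToC Def. 5.14, p. 27–28]
locator: paper:arxiv-1701.05328 p0020.txt:L13; paper:doi-10-4086-toc-2018-v014a018 p0027.txt:L44 -/
def IsIndepMonomialMap {ι τ τ' : Type*} (d ℓ : ℕ) (g : ι → MvPolynomial (τ ⊕ τ') F) : Prop :=
  ∀ S : Finset ι, S.card ≤ ℓ → ∃ (α : τ' → F) (expo : (ι →₀ ℕ) → (τ →₀ ℕ)),
    Set.InjOn expo {a : ι →₀ ℕ | a.support ⊆ S ∧ ∀ i, a i ≤ d} ∧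
    ∀ a : ι →₀ ℕ, a.support ⊆ S → (∀ i, a i ≤ d) →
      ∃ c : F, c ≠ 0 ∧
        ∏ i ∈ a.support, (bind₁ (Sum.elim X (fun j => C (α j))) (g i)) ^ a i = monomial (expo a) c

end ROABP

section RankConcentration

variable {K : Type*} [Field K]

/-- **FSV Def. 39 (ToC Def. 5.15) [ASS13], support-`k` rank concentration at `v`.** Printed: "Let
`F[X] ∈ 𝔽[X]^r` be a vector of polynomials. We say that `F` has support-`k` rank concentration at
`v`, if the derivatives of `F` with respect to all monomials of support at most `k` at `v` span all
the derivatives of `F` at `v`. That is, if `Span{∂_{X^a}(F)(v)}_{a : |supp(a)| ≤ k} = Span{∂_{X^a}(F)(v)}_a`."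
Rendering: `∂_{X^a}(F)(v) ∈ K^r` is taken as the vector of `X^a`-coefficients of the shifted family
`F(X + v)` (the Hasse derivative / Taylor coefficient at `v`, the reading under which the cited
[ASS13, FSS14] statements are made, and the only characteristic-free one); spans over the field `K`
of the entries of `v` (Lemma 40 takes `K = 𝔽(t,s)`). [cite: ForbesShpilkaVolk2018, Def. 39 (seq.) = ToC Def. 5.15, p. 28]
locator: paper:arxiv-1701.05328 p0020.txt:L19; paper:doi-10-4086-toc-2018-v014a018 p0028.txt:L5 -/
def IsRankConcentrated {ι ρ : Type*} (k : ℕ) (Fv : ρ → MvPolynomial ι K) (v : ι → K) : Prop :=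
  Submodule.span K (Set.range fun a : {a : ι →₀ ℕ // a.support.card ≤ k} =>
      fun j : ρ => coeff a.1 (aeval (fun i => (X i + C (v i) : MvPolynomial ι K)) (Fv j))) =
    Submodule.span K (Set.range fun a : ι →₀ ℕ =>
      fun j : ρ => coeff a (aeval (fun i => (X i + C (v i) : MvPolynomial ι K)) (Fv j)))

end RankConcentration

/-- **FSV Lemma 40 (ToC Lemma 5.16) = [Forbes–Saptharishi–Shpilka 2014, Thm. 4.1] — NAMED FACT.**
Printed: "Let `F[X] ∈ 𝔽[X]^{w×w}` be of individual degree `d` and computed by a commutative roABP of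
width `w`. Let `g(t, s)` be an individual degree `d`, `(log(w²)+1)`-wise independent monomial map.
Then `F(X)` has support-`log(w²)` rank concentration at `g(t, s)` over `𝔽(t, s)`." Rendering:
`K = FractionRing 𝔽[t,s]`, the matrix entries mapped into `K[X]`, `v_i` = the image of `g_i` in
`K`; `log(w²) = ⌈log₂(w²)⌉` (seed counts rounded UP — more independence is a weaker hypothesis, the
safe reading of the printed `log`); individual degree `d` = every exponent of every entry `≤ d`; the
variable set `ι` is FINITE (print: the `N` variables `X`; CORRECTION 2026-08-26: the first landed
text allowed any `ι`, and for infinite `ι` the roABP hypothesis `IsCommROABPMatrix` — "for every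
order `Fin N ≃ ι` …" — is vacuous, making the statement false: `ι = ℕ`, `w = d = 1`, `g ≡ t`,
`F = X_0 - X_1` has `F(g) = 0 ≠ F`, so no support-`0` concentration).
[cite: ForbesShpilkaVolk2018, Lemma 40 (seq.) = ToC Lemma 5.16, p. 28; = FSS14 (arXiv:1309.5668) Thm. 28 / Thm. 4.1]
locator: paper:arxiv-1701.05328 p0020.txt:L26; paper:doi-10-4086-toc-2018-v014a018 p0028.txt:L18 -/
def FSV2018_lemma40 : Prop :=
  ∀ (F : Type) [Field F] (ι τ τ' : Type) [Finite ι] (w d : ℕ)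
    (Fm : Matrix (Fin w) (Fin w) (MvPolynomial ι F)) (g : ι → MvPolynomial (τ ⊕ τ') F),
    (∀ a b, ∀ m ∈ (Fm a b).support, ∀ i, m i ≤ d) → IsCommROABPMatrix F w d Fm →
    IsIndepMonomialMap F d (Nat.clog 2 (w ^ 2) + 1) g →
      IsRankConcentrated (K := FractionRing (MvPolynomial (τ ⊕ τ') F)) (Nat.clog 2 (w ^ 2))
        (fun j : Fin w × Fin w =>
          MvPolynomial.map ((algebraMap (MvPolynomial (τ ⊕ τ') F)
            (FractionRing (MvPolynomial (τ ⊕ τ') F))).comp C) (Fm j.1 j.2))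
        (fun i => algebraMap (MvPolynomial (τ ⊕ τ') F) (FractionRing (MvPolynomial (τ ⊕ τ') F)) (g i))

/-- **FSV Lemma 41 (ToC Lemma 5.17) — NAMED FACT.** Printed: "The polynomial map `G^{SSV}_{n,k}(y,z)`
of Construction 25 is an individual degree `d`, `k`-wise independent monomial map for every `d`."
(`t`-block = the `y`'s, fixed block = the `z`'s; in print from Lemma 28.) SCOPE: typed for
`k ≤ 2^n` (at most as many seed blocks as coordinates). In the degenerate range `k > N = 2^n` the
printed sentence fails literally for the `(y | z)` split of Def. 38 — e.g. `n = 0`, `k = 2`: the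
single coordinate of `G^{SSV}_{0,2}` is `y_1 + y_2`, not a monomial, for every fixing of `z`
(there are no `z`'s); the printed proof silently zeroes the spare `y`'s (Lemma 28's "possibly of
some of the `y` variables"), which Def. 38 does not allow. For `k ≤ 2^n` spare blocks can be routed
to a coordinate outside `S`, and the statement holds as printed.
[cite: ForbesShpilkaVolk2018, Lemma 41 (seq.) = ToC Lemma 5.17, p. 28]
locator: paper:arxiv-1701.05328 p0020.txt:L32; paper:doi-10-4086-toc-2018-v014a018 p0028.txt:L23 -/
def FSV2018_lemma41 : Prop :=
  ∀ (F : Type) [Field F] (n k d : ℕ), k ≤ 2 ^ n →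
    IsIndepMonomialMap F d k (fun m : multilinearMonomials n => ssvGenCoeff F n k (m : Fin n →₀ ℕ))

/-- **FSV Lemma 42 (ToC Lemma 5.18) = [FSS14, Cor. 3.5] — NAMED FACT.** Printed: "Let
`F ∈ 𝔽[X]^{r×r}` be a matrix of polynomials that is support-`k` rank concentrated at `α ∈ 𝔽^N`,
and let `G(X) = F_{1,1}`. Then `G(X) ≢ 0` if and only if `G ∘ (G^{SSV}_{n,k} + α) ≢ 0`." Rendering:
over an arbitrary field `K` (Thm. 43 applies it over `𝔽(t,s)`), matrices indexed by
`Fin (r+1) × Fin (r+1)` with `G` the `(0,0)` entry, `N = 2^n` coefficient variables, composition =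
`bind₁` with `G^{SSV}_{n,k} + α`; only the non-trivial direction is typed.
[cite: ForbesShpilkaVolk2018, Lemma 42 (seq.) = ToC Lemma 5.18, p. 28]
locator: paper:arxiv-1701.05328 p0020.txt:L42; paper:doi-10-4086-toc-2018-v014a018 p0028.txt:L31 -/
def FSV2018_lemma42 : Prop :=
  ∀ (K : Type) [Field K] (n k r : ℕ)
    (Fv : Fin (r + 1) × Fin (r + 1) → MvPolynomial (multilinearMonomials n) K)
    (α : multilinearMonomials n → K), IsRankConcentrated k Fv α → Fv (0, 0) ≠ 0 →
      bind₁ (fun m : multilinearMonomials n => ssvGenCoeff K n k (m : Fin n →₀ ℕ) + C (α m))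
        (Fv (0, 0)) ≠ 0

/-- The class of Thm. 43: `N = 2^n`-variate polynomials of individual degree `≤ d` computed by
width-`w` commutative roABPs (in the coefficient variables of the multilinear space).
[cite: ForbesShpilkaVolk2018, Thm. 43 (seq.) = ToC Thm. 5.19, p. 28]
locator: paper:arxiv-1701.05328 p0020.txt:L50; paper:doi-10-4086-toc-2018-v014a018 p0028.txt:L41 -/
def commROABPClass (F : Type*) [CommRing F] (n w d : ℕ) :
    Set (MvPolynomial (multilinearMonomials n) F) :=
  {D | (∀ m ∈ D.support, ∀ v, m v ≤ d) ∧ IsCommROABP F w d D}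

/-- **FSV Thm. 43 (ToC Thm. 5.19) — NAMED FACT.** Printed: "Let `|𝔽| > nd`, and let `F(X) ∈ 𝔽[X]`
be an `N`-variate polynomial of individual degree at most `d`, and computed by a width `w`
commutative roABP. Then, `F ≢ 0` if and only if `F ∘ G^{SSV}_{n, 1+4 log w} ≢ 0`." Rendering: field
size as a finite subset of more than `nd` elements; `log w = ⌈log₂ w⌉` (more seed blocks is the
weaker, safe reading: extra blocks can be zeroed by additivity, Fact 27); generator = FSV Def. 7 (3),
the non-trivial direction. [cite: ForbesShpilkaVolk2018, Thm. 43 (seq.) = ToC Thm. 5.19, p. 28–29]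
locator: paper:arxiv-1701.05328 p0020.txt:L50; paper:doi-10-4086-toc-2018-v014a018 p0028.txt:L41 -/
def FSV2018_thm43 : Prop :=
  ∀ (F : Type) [Field F] (n d w : ℕ), (∃ S : Finset F, n * d < S.card) →
    IsHittingSetGenerator (commROABPClass F n w d)
      (fun m : multilinearMonomials n => ssvGenCoeff F n (1 + 4 * Nat.clog 2 w) (m : Fin n →₀ ℕ))

/-- **FSV Cor. 44 (ToC Cor. 5.20) — NAMED FACT (existence form as printed).** "There exists a
`poly(n, log(w))`-`ΣΠΣ` succinct generator for the class of polynomials computed by width-`w`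
commutative roABPs." Rendering: the field-size hypothesis `|𝔽| > nd` and the individual degree `d`
are inherited from Thm. 43 (Cor. 44 as printed mentions neither); outputs = coefficient vectors of
read-once affine product sums with top fan-in `≤ (⌈log₂ w⌉ + 2)^c` (size `poly(n, log w)`), one
uniform `c`. Witness in print: `G^{SSV}_{n, 1 + 4 log w}` (Fact 26 succinctness, proved here as
`isSuccinctGenerator_ssvGenCoeff`). [cite: ForbesShpilkaVolk2018, Cor. 44 (seq.) = ToC Cor. 5.20, p. 29]
locator: paper:arxiv-1701.05328 p0020.txt:L58; paper:doi-10-4086-toc-2018-v014a018 p0029.txt:L14 -/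
def FSV2018_cor44 : Prop :=
  ∃ c : ℕ, ∀ (F : Type) [Field F] (n d w : ℕ), (∃ S : Finset F, n * d < S.card) →
    ∃ (τ : Type) (_ : Fintype τ) (G : multilinearMonomials n → MvPolynomial τ F),
      IsHittingSetGenerator (commROABPClass F n w d) G ∧
        IsSuccinctGenerator (multilinearMonomials n) (roProductSums F n ((Nat.clog 2 w + 2) ^ c)) G

/-- **Cor. 44 PROVED modulo Thm. 43:** witness `G^{SSV}_{n,1+4⌈log₂ w⌉}`, `c = 2`
(`1 + 4L ≤ (L+2)²`). [cite: ForbesShpilkaVolk2018, Cor. 44 (seq.) = ToC Cor. 5.20, p. 29]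
locator: paper:doi-10-4086-toc-2018-v014a018 p0029.txt:L14 -/
theorem FSV2018_cor44_of_thm43 (h : FSV2018_thm43) : FSV2018_cor44 := by
  refine ⟨2, fun F _ n d w hF => ?_⟩
  refine ⟨Fin (1 + 4 * Nat.clog 2 w) ⊕ (Fin (1 + 4 * Nat.clog 2 w) × Fin n), inferInstance,
    fun m => ssvGenCoeff F n (1 + 4 * Nat.clog 2 w) (m : Fin n →₀ ℕ), h F n d w hF, ?_⟩
  refine (isSuccinctGenerator_ssvGenCoeff (F := F) (n := n) _).mono (roProductSums_mono ?_)
  nlinarith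

/-! ### §5.4 Depth-`D` occur-`k` formulas -/

section Occur

universe u v

mutual
  /-- **FSV Def. 45 (ToC Def. 5.21) [ASSS16], occur-`k` formulas — the syntax.** Printed: "An
  occur-`k` formula is a directed tree, with internal nodes labeled either by `+` or `×∧` (a
  power-product gate). The edges entering a `×∧` gate are labeled by integers `e_1, …, e_m`, and on
  inputs `g_1, …, g_m`, the gate computes `g_1^{e_1} ⋯ g_m^{e_m}`. The leaves of tree are depth-`2`
  formulas which compute sparse polynomials, such that every variable `X_i` occur in at most `k` of
  them." A leaf carries the sparse polynomial it computes; `+` and `×∧` gates carry argument lists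
  (mutual inductive, no instances). [cite: ForbesShpilkaVolk2018, Def. 45 (seq.) = ToC Def. 5.21, p. 29]
  locator: paper:arxiv-1701.05328 p0020.txt:L65; paper:doi-10-4086-toc-2018-v014a018 p0029.txt:L18 -/
  inductive OccurFormula (F : Type u) [CommSemiring F] (ι : Type v) : Type (max u v)
    | leaf : MvPolynomial ι F → OccurFormula F ι
    | add : OccurArgs F ι → OccurFormula F ι
    | powProd : OccurPowArgs F ι → OccurFormula F ι
  /-- Argument lists of `+` gates of occur-`k` formulas. [cite: ForbesShpilkaVolk2018, Def. 45 (seq.) = ToC Def. 5.21, p. 29] -/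
  inductive OccurArgs (F : Type u) [CommSemiring F] (ι : Type v) : Type (max u v)
    | nil : OccurArgs F ι
    | cons : OccurFormula F ι → OccurArgs F ι → OccurArgs F ι
  /-- Argument lists of power-product gates: (child, exponent label of its edge).
  [cite: ForbesShpilkaVolk2018, Def. 45 (seq.) = ToC Def. 5.21, p. 29] -/
  inductive OccurPowArgs (F : Type u) [CommSemiring F] (ι : Type v) : Type (max u v)
    | nil : OccurPowArgs F ι
    | cons : OccurFormula F ι → ℕ → OccurPowArgs F ι → OccurPowArgs F ι
end

variable {F : Type u} [CommSemiring F] {ι : Type v}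

mutual
  /-- Semantics of an occur-`k` formula ("on inputs `g_1, …, g_m`, the [`×∧`] gate computes
  `g_1^{e_1} ⋯ g_m^{e_m}`"; `+` gates add; leaves are their sparse polynomial).
  [cite: ForbesShpilkaVolk2018, Def. 45 (seq.) = ToC Def. 5.21, p. 29] -/
  def OccurFormula.eval : OccurFormula F ι → MvPolynomial ι F
    | .leaf p => p
    | .add as => OccurArgs.evalSum as
    | .powProd ps => OccurPowArgs.evalProd ps
  /-- Sum of the values of a `+` gate's arguments. [cite: ForbesShpilkaVolk2018, Def. 45 (seq.) = ToC Def. 5.21, p. 29] -/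
  def OccurArgs.evalSum : OccurArgs F ι → MvPolynomial ι F
    | .nil => 0
    | .cons φ as => OccurFormula.eval φ + OccurArgs.evalSum as
  /-- Power product of a `×∧` gate's arguments. [cite: ForbesShpilkaVolk2018, Def. 45 (seq.) = ToC Def. 5.21, p. 29] -/
  def OccurPowArgs.evalProd : OccurPowArgs F ι → MvPolynomial ι F
    | .nil => 1
    | .cons φ e ps => OccurFormula.eval φ ^ e * OccurPowArgs.evalProd ps
end

mutual
  /-- **Size** (Def. 45): "The size of a `+` gate is `1`, The size of a `×∧` gate is the sum
  `e_1 + ⋯ + e_m` of the labels of its incoming edges, and The size of a leaf node is the size of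
  the depth-`2` formula it is computing". FSV §1: "The size of the circuit is defined to be the
  number of wires"; a `ΣΠ` formula for `p = ∑_m c_m X^m` has one wire into the `+` gate per
  monomial and `deg m` variable wires into that monomial's `×` gate, so a leaf is measured by
  `∑_{m ∈ supp p} (deg m + 1)` — a bound on BOTH the sparsity and the degree of the leaf, which is
  what [ASSS16] use ("sparsity bounded by `s` … degree bounded by `sR`", arXiv:1111.0582 §3;
  their `char > s^R` hypothesis is a degree bound). (CORRECTION 2026-08-26: the first landed text
  measured a leaf by its number of monomials only, under which `s` does not bound degrees and the
  typed Thm. 48 / Cor. 49 would claim more than [ASSS16] prove in positive characteristic.)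
  [cite: ForbesShpilkaVolk2018, Def. 45 (seq.) = ToC Def. 5.21, p. 29; §1 (size = number of wires)] -/
  def OccurFormula.size : OccurFormula F ι → ℕ
    | .leaf p => ∑ m ∈ p.support, (m.degree + 1)
    | .add as => 1 + OccurArgs.size as
    | .powProd ps => OccurPowArgs.size ps
  /-- Total size of a `+` gate's arguments. [cite: ForbesShpilkaVolk2018, Def. 45 (seq.) = ToC Def. 5.21, p. 29] -/
  def OccurArgs.size : OccurArgs F ι → ℕ
    | .nil => 0
    | .cons φ as => OccurFormula.size φ + OccurArgs.size as
  /-- Exponent labels plus sizes of a `×∧` gate's arguments. [cite: ForbesShpilkaVolk2018, Def. 45 (seq.) = ToC Def. 5.21, p. 29] -/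
  def OccurPowArgs.size : OccurPowArgs F ι → ℕ
    | .nil => 0
    | .cons φ e ps => e + OccurFormula.size φ + OccurPowArgs.size ps
end

mutual
  /-- **Depth** (Def. 45): "the number of layers of `+` and `×∧` gates, plus `2`, to account for
  the sparse formulas at the leaves". [cite: ForbesShpilkaVolk2018, Def. 45 (seq.) = ToC Def. 5.21, p. 29] -/
  def OccurFormula.depth : OccurFormula F ι → ℕ
    | .leaf _ => 2
    | .add as => 1 + OccurArgs.depth as
    | .powProd ps => 1 + OccurPowArgs.depth ps
  /-- Maximal depth among a `+` gate's arguments. [cite: ForbesShpilkaVolk2018, Def. 45 (seq.) = ToC Def. 5.21, p. 29] -/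
  def OccurArgs.depth : OccurArgs F ι → ℕ
    | .nil => 0
    | .cons φ as => max (OccurFormula.depth φ) (OccurArgs.depth as)
  /-- Maximal depth among a `×∧` gate's arguments. [cite: ForbesShpilkaVolk2018, Def. 45 (seq.) = ToC Def. 5.21, p. 29] -/
  def OccurPowArgs.depth : OccurPowArgs F ι → ℕ
    | .nil => 0
    | .cons φ _ ps => max (OccurFormula.depth φ) (OccurPowArgs.depth ps)
end

mutual
  /-- **Occurrences** (Def. 45: "every variable `X_i` occur in at most `k` of them [the leaves]"):
  the number of leaves whose sparse polynomial involves `X_i`. [cite: ForbesShpilkaVolk2018, Def. 45 (seq.) = ToC Def. 5.21, p. 29] -/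
  def OccurFormula.occur (i : ι) : OccurFormula F ι → ℕ
    | .leaf p => if p.degreeOf i = 0 then 0 else 1
    | .add as => OccurArgs.occur i as
    | .powProd ps => OccurPowArgs.occur i ps
  /-- Occurrences of `X_i` among a `+` gate's arguments. [cite: ForbesShpilkaVolk2018, Def. 45 (seq.) = ToC Def. 5.21, p. 29] -/
  def OccurArgs.occur (i : ι) : OccurArgs F ι → ℕ
    | .nil => 0
    | .cons φ as => OccurFormula.occur i φ + OccurArgs.occur i as
  /-- Occurrences of `X_i` among a `×∧` gate's arguments. [cite: ForbesShpilkaVolk2018, Def. 45 (seq.) = ToC Def. 5.21, p. 29] -/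
  def OccurPowArgs.occur (i : ι) : OccurPowArgs F ι → ℕ
    | .nil => 0
    | .cons φ _ ps => OccurFormula.occur i φ + OccurPowArgs.occur i ps
end

end Occur

section OccurClass

variable (F : Type*) [CommRing F]

/-- The class of polynomials computed by size-`≤ s`, depth-`≤ D`, occur-`k` formulas (Def. 45;
Thm. 48 / Cor. 49: "polynomials computed by size-`s` depth-`D` occur-`k` formulas"; bounds read as
"at most"). [cite: ForbesShpilkaVolk2018, Def. 45 and Cor. 49 (seq.) = ToC Def. 5.21 and Cor. 5.25, pp. 29–30]
locator: paper:arxiv-1701.05328 p0020.txt:L65; paper:doi-10-4086-toc-2018-v014a018 p0029.txt:L18 -/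
def occurClass (ι : Type*) (D k s : ℕ) : Set (MvPolynomial ι F) :=
  {f | ∃ φ : OccurFormula F ι, φ.eval = f ∧ φ.depth ≤ D ∧ (∀ i, φ.occur i ≤ k) ∧ φ.size ≤ s}

/-- The parameter `R = (2k)^{2D·2^D}` of Construction 46 / Thm. 48.
[cite: ForbesShpilkaVolk2018, Construction 46 (seq.) = ToC Construction 5.22, p. 29]
locator: paper:arxiv-1701.05328 p0021.txt:L11; paper:doi-10-4086-toc-2018-v014a018 p0029.txt:L35 -/
def asssR (k D : ℕ) : ℕ := (2 * k) ^ (2 * D * 2 ^ D)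

/-- The number of SV seed blocks `R log s + R log R` of Construction 46 (`log = ⌈log₂⌉`, the safe
reading: more blocks is weaker). [cite: ForbesShpilkaVolk2018, Construction 46 (seq.) = ToC Construction 5.22, p. 29]
locator: paper:doi-10-4086-toc-2018-v014a018 p0029.txt:L35 -/
def asssK (k D s : ℕ) : ℕ := asssR k D * Nat.clog 2 s + asssR k D * Nat.clog 2 (asssR k D)

/-- **FSV Construction 46 (ToC 5.22), the succinct generator for depth-`D` occur-`k` formulas, as
a polynomial map.** Printed: "`P^{ASSS}(x, y_1, …, y_{D-2}, t_1, …, t_ℓ, u, v) =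
∑_{ℓ=1}^{D-2} G^{RC}_{n,R}(x_1, …, x_n, y_ℓ, t_ℓ) + Q^{SSSV}_{n, R log s + R log R}(x, u, v)`, and the
generator `G^{ASSS} = coeff_x(P^{ASSS})`" (with `P^{RC}` meant in the sum). Coordinate-wise: `D-2`
rank-condenser blocks on disjoint seeds plus one shifted SV block (tree: `svGenCoeff`).
[cite: ForbesShpilkaVolk2018, Construction 46 (seq.) = ToC Construction 5.22, p. 29]
locator: paper:arxiv-1701.05328 p0021.txt:L11; paper:doi-10-4086-toc-2018-v014a018 p0029.txt:L35 -/
def asssGenCoeff (D k n s : ℕ) (m : Fin n →₀ ℕ) :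
    MvPolynomial ((Fin (D - 2) × (Fin (asssR k D) ⊕ Fin (n + 1))) ⊕
      (Fin (asssK k D s) ⊕ (Fin (asssK k D s) × Fin n))) F :=
  (∑ ℓ : Fin (D - 2), rename (fun v => Sum.inl (ℓ, v)) (rcGenCoeff F n (asssR k D) m)) +
    rename Sum.inr (svGenCoeff F n (asssK k D s) m)

variable {F} {n : ℕ}

/-- A sum of `L` read-once affine product sums of top fan-in `R` each has top fan-in `L·R`
("`poly(k,n)`-`ΣΠΣ` circuits are closed under addition", proof of Thm. 24; the `D-2` blocks of
Construction 46). [cite: ForbesShpilkaVolk2018, Thm. 24 and Construction 46 (seq.) = ToC Thm. 4.9 and Construction 5.22, pp. 23, 29] -/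
theorem sum_mem_roProductSums {L R : ℕ} (f : Fin L → MvPolynomial (Fin n) F)
    (hf : ∀ ℓ, f ℓ ∈ roProductSums F n R) : ∑ ℓ, f ℓ ∈ roProductSums F n (L * R) := by
  induction L with
  | zero => simpa using zero_mem_roProductSums (F := F) (n := n) 0
  | succ L ih =>
    rw [Fin.sum_univ_castSucc, Nat.succ_mul]
    exact add_mem_roProductSums (ih (fun ℓ => f (Fin.castSucc ℓ)) fun ℓ => hf _) (hf _)

/-- **FSV Fact 47 (ToC Fact 5.23), succinctness of Construction 46, PROVED (uniformly, not only
for `k, D = O(1)`):** every output of `G^{ASSS}` is the coefficient vector of a read-once affine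
product sum with top fan-in `(D-2)·R + (R log s + R log R) + 1` — `poly(log s, n)` for `k, D = O(1)`
("For `k,D = O(1)`, the generator of Construction 46 is `poly(log s, n)`-`ΣΠΣ` succinct").
[cite: ForbesShpilkaVolk2018, Fact 47 (seq.) = ToC Fact 5.23, p. 30]
locator: paper:arxiv-1701.05328 p0021.txt:L25; paper:doi-10-4086-toc-2018-v014a018 p0030.txt:L3 -/
theorem isSuccinctGenerator_asssGenCoeff (D k s : ℕ) :
    IsSuccinctGenerator (multilinearMonomials n)
      (roProductSums F n ((D - 2) * asssR k D + (asssK k D s + 1)))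
      (fun m : multilinearMonomials n => asssGenCoeff F D k n s (m : Fin n →₀ ℕ)) := by
  intro a
  choose f hf hfa using fun ℓ : Fin (D - 2) =>
    isSuccinctGenerator_rcGenCoeff (F := F) (n := n) (asssR k D) (fun v => a (Sum.inl (ℓ, v)))
  obtain ⟨g, hg, hga⟩ := isSuccinctGenerator_svGenCoeff (F := F) (n := n) (asssK k D s) (a ∘ Sum.inr)
  refine ⟨(∑ ℓ, f ℓ) + g, add_mem_roProductSums (sum_mem_roProductSums f hf) hg, ?_⟩
  funext m
  have h2 := congrFun hga m
  simp only [coeffVector_apply, genOutput_apply] at h2 ⊢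
  rw [coeff_add, coeff_sum, h2, asssGenCoeff, map_add, map_sum, eval_rename]
  congr 1
  refine Finset.sum_congr rfl fun ℓ _ => ?_
  have h1 := congrFun (hfa ℓ) m
  simp only [coeffVector_apply, genOutput_apply] at h1
  rw [h1, eval_rename]
  rfl

end OccurClass

/-- **FSV Thm. 48 (ToC Thm. 5.24), "(a variant of) a theorem proved by Agrawal et al." [ASSS16;
Chapter 4 of Saptharishi's survey] — NAMED FACT.** Printed: "Suppose `Φ(w) : 𝔽^m → 𝔽^N` is a map
such that for any polynomial `F(X) ∈ 𝔽[X]` of sparsity at most `R!·s^R`, `F ∘ Φ ≢ 0`. Then there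
exist integers `r_1, …, r_{D-2} ∈ [R]`, for `R = (2k)^{2D·2^D}` such that the map
`Ψ : X_i ↦ ∑_{ℓ=1}^{D-2} (∑_{j=1}^{r_ℓ} y_{j,ℓ} t_ℓ^{ij}) + Φ(w)` is a generator for polynomials
computed by depth-`D` occur-`k` formulas of size `s` assuming `char(𝔽) = 0` or `char(𝔽) > s^R`."
Rendering: `Φ` a polynomial map on any seed type that is a hitting-set generator for the polynomials
with at most `R!·s^R` monomials (nonzero ones — FSV Def. 7 (3)); `N = 2^n`, `i = binIndex m`; the
`r_ℓ`-term Vandermonde blocks are `vdmGenCoeff n r_ℓ` re-indexed into `R` seed slots, `r_ℓ ∈ [R]`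
read as `r_ℓ ≤ R` (CORRECTION 2026-08-26: the first landed text also demanded `1 ≤ r_ℓ`, which makes
the statement FALSE in the degenerate case `k = 0`, `D ≥ 3`: there `R = 0`, the printed range `[R]`
is empty, yet occur-`0` formulas — whose leaves are constants — are hit by every map; with empty
blocks allowed the `k = 0` case is true and the `k ≥ 1` content is as printed).
PROVENANCE CAVEAT B21/B23 (val-lit PRINT-ERRATA registry: B21 = Thm. 48 quoted for the whole
class, [rp] Ch. 4; B23 = the post-reduction constants, defect id D13; val-lit p1 g3 / lead-np
RULINGS (31), (33), 2026-08-26; memo HOME/np/p1g3-THM48-provenance-and-plan.md): [ASSS16] §4 (arXiv:1111.0582 p0009:L3–L22, p0010)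
proves the generator/faithful-map statement only for formulas whose top `+` gate has fan-in `≤ k`
("by reusing symbols"), with `char > s^R` for THOSE parameters; general top fan-in is reached there
by a hitting-SET step (the shifts `α + e_i`), i.e. after passing to depth `D+1`, occur `2k`, size
`≤ s² + s`. This typed statement (generator form for all of `occurClass`, abstract `Φ`, threshold
`s^{R(k,D)}`) is FSV's print verbatim but NOT literally covered by the cited proof. STATUS
(2026-08-27, supersedes "NOT refuted (truth open)"): **PROVED IN THE TREE AS TYPED** —
`FSV2018_thm48_holds` (`AC/FSV18Thm48Holds.lean`, val-lit p2 g9 / t18 g9, 2026-08-27) by an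
argument NOT in [ASSS16]/FSV/[rp]:
[ASSS16]'s level recursion (the tree's `thm48_levelInvariant_step`) RE-BASED AT DEPTH 3
(`ASSS16.baseLevelDepthThree`, `AC/ASSS16BaseLevelDepthThree.lean`: gcd trick + sparsity of the
residual Jacobian minor, hit by `Φ` directly; numerics `AC/ASSS16DepthThreeNumerics.lean`, val-lit
t20 g10), which frees one of the `D - 2` Vandermonde blocks for a FIRST-ORDER EXTRACTION along one
seed (`ASSS16.map_pderiv_eq_zero_of_aeval_vdmBlock_add_eq_zero`, `AC/FSV18VandermondeExtraction.lean`):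
`Ψ(C) = 0 ⟹ Ψ'(∂_m C) = 0` for all `m`, and `∂_m C` of a `+` gate of ANY fan-in is carried by the
`≤ k` children containing `x_m` — this is where the general top fan-in is met. So the printed
statement is TRUE as typed (printed `R`, printed `D - 2` blocks, printed characteristic clause);
the caveat above now concerns ATTRIBUTION only (registry B21/B23). Before that proof the fact was not
consumed by the load-bearing chain except through `FSV2018_cor49_of_thm48`; the tree's first route
to Cor. 49 was the bounded-top-fan-in theorem + the generator-form shift for the SV block
(`ASSS16.isHittingSetGenerator_succ_of_unitDifferences`, `FSV18OccurShiftReduction.lean`).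
[cite: ForbesShpilkaVolk2018, Thm. 48 (seq.) = ToC Thm. 5.24, p. 30]
locator: paper:arxiv-1701.05328 p0021.txt:L31; paper:doi-10-4086-toc-2018-v014a018 p0030.txt:L6 -/
def FSV2018_thm48 : Prop :=
  ∀ (F : Type) [Field F] (n D k s : ℕ) (τ : Type)
    (Φ : multilinearMonomials n → MvPolynomial τ F),
    (ringChar F = 0 ∨ s ^ asssR k D < ringChar F) →
    IsHittingSetGenerator
      {P : MvPolynomial (multilinearMonomials n) F |
        P.support.card ≤ (asssR k D).factorial * s ^ asssR k D} Φ →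
    ∃ r : Fin (D - 2) → Fin (asssR k D + 1),
      IsHittingSetGenerator (occurClass F (multilinearMonomials n) D k s)
        (fun m : multilinearMonomials n =>
          (∑ ℓ : Fin (D - 2),
            rename (fun v : Fin (r ℓ) ⊕ Unit =>
                (Sum.inl (ℓ, Sum.map (Fin.castLE (Nat.lt_succ_iff.mp (r ℓ).isLt)) id v) :
                  (Fin (D - 2) × (Fin (asssR k D) ⊕ Unit)) ⊕ τ))
              (vdmGenCoeff F n (r ℓ) (m : Fin n →₀ ℕ))) +
            rename Sum.inr (Φ m))

/-- **FSV Cor. 49 (ToC Cor. 5.25), hitting half — NAMED FACT.** Printed: "For `D, k = O(1)`,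
Construction 46 is a `poly(log s, n)`-`ΣΠΣ` succinct generator for the class of polynomials
computed by size-`s` depth-`D` occur-`k` formulas." The succinctness half is PROVED above
(`isSuccinctGenerator_asssGenCoeff`); typed here: `G^{ASSS}` (this file's `asssGenCoeff D k n s`)
is a hitting-set generator for `occurClass _ D k s` in the `N = 2^n` coefficient variables, under the
characteristic hypothesis of Thm. 48 (`char = 0` or `> s^R`), which the printed Cor. 49 inherits
from Thm. 48 without restating it. In print from Thm. 48 + Cor. 34 + Prop. 17.
PROVENANCE CAVEAT B23 (see `FSV2018_thm48`, B21/B23; defect id D13): in positive characteristic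
the inherited threshold `s^{R(k,D)} < char` is weaker than what [ASSS16]'s printed route gives for
the full class (`(s²+s)^{R(2k,D+1)}`, after the top-fan-in reduction); characteristic `0` is
unaffected. [cite: ForbesShpilkaVolk2018, Cor. 49 (seq.) = ToC Cor. 5.25, p. 30]
locator: paper:arxiv-1701.05328 p0021.txt:L41; paper:doi-10-4086-toc-2018-v014a018 p0030.txt:L25 -/
def FSV2018_cor49 : Prop :=
  ∀ (F : Type) [Field F] (n D k s : ℕ), (ringChar F = 0 ∨ s ^ asssR k D < ringChar F) →
    IsHittingSetGenerator (occurClass F (multilinearMonomials n) D k s)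
      (fun m : multilinearMonomials n => asssGenCoeff F D k n s (m : Fin n →₀ ℕ))

/-! ## §1.5: the summary theorems Thm. 9 / Thm. 10 / Cor. 11 (ToC 1.10–1.12), AS PRINTED

The hitting-set side of Thm. 9 is the class of "`poly(log s, n)`-size multilinear `ΣΠΣ` formulas";
every construction of §§4–6 produces read-once affine product sums, which are such formulas
(`roProductSums_subset_multilinearSPS`). -/

section MultilinearSPS

variable (F : Type*) [CommRing F] {n : ℕ}

/-- **Multilinear `ΣΠΣ` formulas of size `≤ S`** (Thm. 9: "the set of `poly(log s, n)`-size
multilinear `ΣΠΣ` formulas"): `∑_{j<k} ∏_{i<d_j} ℓ_{j,i}` with every `ℓ_{j,i}` of total degree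
`≤ 1`, the forms under one product gate having pairwise disjoint variable sets (syntactic
multilinearity), and size `k + ∑_j d_j ≤ S` (product gates plus linear forms; any of the usual
`ΣΠΣ` size measures is within a factor `n + 1` of this one, immaterial for `poly(log s, n)`).
[cite: ForbesShpilkaVolk2018, Thm. 9 (seq.) = ToC Thm. 1.10, p. 14]
locator: paper:arxiv-1701.05328 p0011.txt:L1; paper:doi-10-4086-toc-2018-v014a018 p0014.txt:L42 -/
def IsMultilinearSPS (S : ℕ) (f : MvPolynomial (Fin n) F) : Prop :=
  ∃ (k : ℕ) (d : Fin k → ℕ) (ℓ : (j : Fin k) → Fin (d j) → MvPolynomial (Fin n) F),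
    (∀ j i, (ℓ j i).totalDegree ≤ 1) ∧
    (∀ j i i', i ≠ i' → Disjoint (ℓ j i).vars (ℓ j i').vars) ∧
    k + ∑ j, d j ≤ S ∧ f = ∑ j, ∏ i, ℓ j i

/-- The class of multilinear `ΣΠΣ` formulas of size `≤ S` in `x_1, …, x_n`.
[cite: ForbesShpilkaVolk2018, Thm. 9 (seq.) = ToC Thm. 1.10, p. 14]
locator: paper:doi-10-4086-toc-2018-v014a018 p0014.txt:L42 -/
def multilinearSPS (n S : ℕ) : Set (MvPolynomial (Fin n) F) :=
  {f | IsMultilinearSPS F S f}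

variable {F}

/-- Monotonicity of the size bound. [folklore] -/
private theorem multilinearSPS_mono {S S' : ℕ} (h : S ≤ S') : multilinearSPS F n S ⊆ multilinearSPS F n S' := by
  rintro f ⟨k, d, ℓ, h1, h2, h3, h4⟩
  exact ⟨k, d, ℓ, h1, h2, h3.trans h, h4⟩

end MultilinearSPS

section MultilinearSPSField

variable {F : Type*} [Field F] {n : ℕ}

/-- The variables of an affine univariate form `a x_i + b` are among `{i}`. [folklore] -/
private theorem vars_C_mul_X_add_C_subset (a b : F) (i : Fin n) :
    (C a * X i + C b : MvPolynomial (Fin n) F).vars ⊆ {i} := by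
  refine (vars_add_subset _ _).trans (Finset.union_subset ?_ ?_)
  · refine (vars_mul _ _).trans (Finset.union_subset ?_ ?_)
    · simp [vars_C]
    · simp [vars_X]
  · simp [vars_C]

/-- An affine univariate form has total degree `≤ 1`. [folklore] -/
private theorem totalDegree_C_mul_X_add_C_le (a b : F) (i : Fin n) :
    (C a * X i + C b : MvPolynomial (Fin n) F).totalDegree ≤ 1 := by
  refine (totalDegree_add _ _).trans (max_le ?_ ?_)
  · refine (totalDegree_mul _ _).trans ?_
    rw [totalDegree_C, totalDegree_X, zero_add]
  · rw [totalDegree_C]; exact Nat.zero_le _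

/-- **Read-once affine product sums are multilinear `ΣΠΣ` formulas (PROVED):** top fan-in `k` gives
size `≤ k(n+2)` (per product gate: the scalar as a constant form plus `n` affine univariate forms in
distinct variables). [cite: ForbesShpilkaVolk2018, Thm. 9 and §1.5 (seq.) = ToC Thm. 1.10, p. 14]
locator: paper:doi-10-4086-toc-2018-v014a018 p0014.txt:L40 -/
theorem roProductSums_subset_multilinearSPS (k : ℕ) :
    roProductSums F n k ⊆ multilinearSPS F n (k * (n + 2)) := by
  rintro f ⟨c, a, b, rfl⟩
  refine ⟨k, fun _ => n + 1,
    fun j => Fin.cases (C (c j)) (fun i => C (a j i) * X i + C (b j i)), ?_, ?_, ?_, ?_⟩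
  · intro j i
    refine Fin.cases ?_ (fun i => ?_) i
    · simp
    · simpa using totalDegree_C_mul_X_add_C_le (a j i) (b j i) i
  · intro j i i' hii'
    revert hii'
    refine Fin.cases ?_ (fun i₀ => ?_) i <;> refine Fin.cases ?_ (fun i₀' => ?_) i' <;> intro hii'
    · exact absurd rfl hii'
    · simp [vars_C]
    · simp [vars_C]
    · have hne : i₀ ≠ i₀' := fun h => hii' (by rw [h])
      simp only [Fin.cases_succ]
      exact Finset.disjoint_of_subset_left (vars_C_mul_X_add_C_subset _ _ _)
        (Finset.disjoint_of_subset_right (vars_C_mul_X_add_C_subset _ _ _)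
          (Finset.disjoint_singleton.2 hne))
  · simp; ring_nf; rfl
  · rw [affineProductSum]
    refine Finset.sum_congr rfl fun j _ => ?_
    rw [Fin.prod_univ_succ]
    simp

variable (F)

/-- **The shape of every bullet of Thm. 9:** in the space of multilinear polynomials in
`x_1, …, x_n` (coefficient coordinates = the `N = 2^n` multilinear monomials), the multilinear `ΣΠΣ`
formulas of size `≤ S` are a succinct hitting set (FSV Def. 3, the tree's `IsSuccinctHittingSet`)
for the class `𝒟` of `N`-variate distinguishers. [cite: ForbesShpilkaVolk2018, Thm. 9 (seq.) = ToC Thm. 1.10, p. 14]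
locator: paper:arxiv-1701.05328 p0011.txt:L1; paper:doi-10-4086-toc-2018-v014a018 p0014.txt:L42 -/
def MultilinearSPSHits (n S : ℕ) (𝒟 : Set (MvPolynomial (multilinearMonomials n) F)) : Prop :=
  IsSuccinctHittingSet (multilinearMonomials n) (multilinearSPS F n S) 𝒟

variable {F}

/-- **From a succinct generator to a bullet of Thm. 9 (PROVED; FSV Lemma 14 over an infinite
field = the tree's `isSuccinctHittingSet_of_generator`):** a hitting-set generator for `𝒟` whose
outputs are coefficient vectors of read-once affine product sums of top fan-in `K` makes the
multilinear `ΣΠΣ` formulas of size `K(n+2)` a succinct hitting set for `𝒟` ("All of our succinct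
derandomization results will be via succinct generators", §1.5).
[cite: ForbesShpilkaVolk2018, Thm. 9 and Lemma 14 (seq.) = ToC Thm. 1.10 and Lemma 3.3, pp. 14, 19]
locator: paper:doi-10-4086-toc-2018-v014a018 p0014.txt:L35 -/
theorem multilinearSPSHits_of_generator [Infinite F] {K S : ℕ} {τ : Type*}
    {𝒟 : Set (MvPolynomial (multilinearMonomials n) F)} {G : multilinearMonomials n → MvPolynomial τ F}
    (hgen : IsHittingSetGenerator 𝒟 G)
    (hsucc : IsSuccinctGenerator (multilinearMonomials n) (roProductSums F n K) G)
    (hKS : K * (n + 2) ≤ S) : MultilinearSPSHits F n S 𝒟 :=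
  isSuccinctHittingSet_of_generator hgen
    (hsucc.mono ((roProductSums_subset_multilinearSPS K).trans (multilinearSPS_mono hKS)))

end MultilinearSPSField

section SparseTrdeg

variable (F : Type*) [CommRing F]

/-- **The class of Thm. 9, last bullet / §6 (Cor. 54): "arbitrary circuits composed with sparse
polynomials of transcendence degree `O(1)`"** — `C(F_1, …, F_m)` with every `F_i` of sparsity
`≤ s` and degree `≤ d` and `trdeg{F_1, …, F_m} ≤ r`, `C` any polynomial (§6: "circuits of the form
`C(F_1, …, F_m)` where the `f_i`'s are polynomials of maximal sparsity `s`, `trdeg{F_1, …, F_m} = r`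
and `C` is an arbitrary circuit"; the degree bound `d` enters the characteristic hypothesis of
Fact 51 / Lemma 52). The lemmas of §6 (Def. 50–Cor. 54) are typed by the §6–8 seat over this class.
[cite: ForbesShpilkaVolk2018, Thm. 9 and §6 (seq.) = ToC Thm. 1.10 and §6, pp. 15, 30]
locator: paper:arxiv-1701.05328 p0022.txt:L1; paper:doi-10-4086-toc-2018-v014a018 p0030.txt:L51 -/
def sparseTrdegClass (ι : Type*) (r s d : ℕ) : Set (MvPolynomial ι F) :=
  {f | ∃ (M : ℕ) (G : Fin M → MvPolynomial ι F) (C' : MvPolynomial (Fin M) F),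
    (∀ i, (G i).support.card ≤ s ∧ (G i).totalDegree ≤ d) ∧ TrdegLE F G r ∧ f = aeval G C'}

end SparseTrdeg

/-- **FSV Thm. 9 (ToC Thm. 1.10), bullet "`Σ^{O(1)}ΠΣ` formulas" — NAMED FACT.** "In the space of
multilinear polynomials, the set of `poly(log s, n)`-size multilinear `ΣΠΣ` formulas is a succinct
hitting set for `N = 2^n`-variate size-`s` computations of the form `Σ^{O(1)}ΠΣ` formulas (§4.1)".
Rendering: for every top fan-in `k` (the `O(1)`) one exponent `c`; over every INFINITE field
(hitting SETS need a large field — FSV §1.2 "large enough fields"; the theorem as printed states no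
field hypothesis); size-`s` `Σ^kΠΣ` formulas have degree `≤ s`, and the class typed is all `Σ^kΠΣ`
formulas of degree `≤ s` (which is what Cor. 22 delivers: its generator depends on `k, d` only).
[cite: ForbesShpilkaVolk2018, Thm. 9 (seq.) = ToC Thm. 1.10, p. 14–15, bullet 1; Cor. 22 = ToC Cor. 4.7]
locator: paper:arxiv-1701.05328 p0011.txt:L4; paper:doi-10-4086-toc-2018-v014a018 p0015.txt:L2 -/
def FSV2018_thm9_spsk : Prop :=
  ∀ k : ℕ, ∃ c : ℕ, ∀ (F : Type) [Field F] [Infinite F] (n s : ℕ),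
    MultilinearSPSHits F n ((Nat.log 2 s + n + 2) ^ c) (spskClass F (multilinearMonomials n) k s)

/-- **FSV Thm. 9 (ToC Thm. 1.10), bullet "`ΣΠΣ` formulas of transcendence degree `≤ O(1)`" (§4.2)
— NAMED FACT.** Rendering: for every `k` one exponent `c`; class `trdegProductClass _ k d`
(`C(T_1, …, T_M)`, `T_i` products of `d` linear forms, `trdeg ≤ k`); succinctness `poly(k, n)`,
independent of `s` (Thm. 24); the characteristic hypothesis of §4.2 (Lemma 23 / Thm. 24), not
restated in Thm. 9, is carried in its corrected STRICT form `char = 0` or `> d^k` (erratum note at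
`FSV2018_lemma23`); infinite field.
[cite: ForbesShpilkaVolk2018, Thm. 9 (seq.) = ToC Thm. 1.10, p. 15, bullet 2; Thm. 24 = ToC Thm. 4.9]
locator: paper:arxiv-1701.05328 p0011.txt:L6; paper:doi-10-4086-toc-2018-v014a018 p0015.txt:L3 -/
def FSV2018_thm9_trdeg : Prop :=
  ∀ k : ℕ, ∃ c : ℕ, ∀ (F : Type) [Field F] [Infinite F] (n d : ℕ),
    (ringChar F = 0 ∨ d ^ k < ringChar F) →
      MultilinearSPSHits F n ((n + 2) ^ c) (trdegProductClass F (multilinearMonomials n) k d)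

/-- **FSV Thm. 9 (ToC Thm. 1.10), bullet "Sparse polynomials" (§5.1) — NAMED FACT.** The
multilinear `ΣΠΣ` formulas of size `(⌊log₂ s⌋ + n + 2)^c` are a succinct hitting set for the
`N = 2^n`-variate polynomials with at most `s` monomials; infinite field. Reduced below to the
tree's generator fact `ForbesShpilkaVolk2018_svGeneratorHitsSparse` (Cor. 34).
[cite: ForbesShpilkaVolk2018, Thm. 9 (seq.) = ToC Thm. 1.10, p. 15, bullet 3; Cor. 34 = ToC Cor. 5.10]
locator: paper:arxiv-1701.05328 p0011.txt:L8; paper:doi-10-4086-toc-2018-v014a018 p0015.txt:L4 -/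
def FSV2018_thm9_sparse : Prop :=
  ∃ c : ℕ, ∀ (F : Type) [Field F] [Infinite F] (n s : ℕ),
    MultilinearSPSHits F n ((Nat.log 2 s + n + 2) ^ c)
      {D : MvPolynomial (multilinearMonomials n) F | D.support.card ≤ s}

/-- **FSV Thm. 9 (ToC Thm. 1.10), bullet "`Σm∧ΣΠ^{O(1)}`-formulas" (§5.2) — NAMED FACT.** For every
bottom degree `t` one exponent `c`; class `smespClass _ s t` (top fan-in `s` = the size parameter);
infinite field. ERRATUM / provenance (D8, safe reading, val-lit lead-np ruling (17)): the hit class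
is restricted to the formulas `P` with `ringChar F = 0 ∨ P.totalDegree < ringChar F` (the
hypothesis of [Forbes15] Prop. 6.5 / Cor. 6.7 / Rem. 4.16 behind Lemma 36; FSV arXiv p0011:L10,
p0019:L64–L68 and ToC p024:L15–L17 print none). Equal to print in characteristic `0`; weaker
otherwise; the by-name conjunction `FSV2018_thm9` below inherits this reading of its `Σm∧ΣΠ`
conjunct. [cite: ForbesShpilkaVolk2018, Thm. 9 (seq.) = ToC Thm. 1.10, p. 15, bullet 4; Thm. 37 = ToC Thm. 5.13]
[cite: Forbes2015, Cor. 6.7 (characteristic hypothesis)]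
locator: paper:arxiv-1701.05328 p0011.txt:L10; paper:doi-10-4086-toc-2018-v014a018 p0015.txt:L5 -/
def FSV2018_thm9_smesp : Prop :=
  ∀ t : ℕ, ∃ c : ℕ, ∀ (F : Type) [Field F] [Infinite F] (n s : ℕ),
    MultilinearSPSHits F n ((Nat.log 2 s + n + 2) ^ c)
      {P | P ∈ smespClass F (multilinearMonomials n) s t ∧ (ringChar F = 0 ∨ P.totalDegree < ringChar F)}

/-- **FSV Thm. 9 (ToC Thm. 1.10), bullet "Commutative roABPs" (§5.3) — NAMED FACT.** Width `w`
(= the size parameter `s` of Thm. 9; succinctness `poly(log w, n)`, `log = ⌈log₂⌉` as in the typed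
Thm. 43 — immaterial up to `c`), any individual degree `d`; infinite field (so Thm. 43's `|𝔽| > nd`
holds). [cite: ForbesShpilkaVolk2018, Thm. 9 (seq.) = ToC Thm. 1.10, p. 15, bullet 5; Cor. 44 = ToC Cor. 5.20]
locator: paper:arxiv-1701.05328 p0011.txt:L12; paper:doi-10-4086-toc-2018-v014a018 p0015.txt:L6 -/
def FSV2018_thm9_commROABP : Prop :=
  ∃ c : ℕ, ∀ (F : Type) [Field F] [Infinite F] (n w d : ℕ),
    MultilinearSPSHits F n ((Nat.clog 2 w + n + 2) ^ c) (commROABPClass F n w d)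

/-- **FSV Thm. 9 (ToC Thm. 1.10), bullet "Depth-`O(1)` Occur-`O(1)` formulas" (§5.4) — NAMED
FACT.** For every depth `D` and occurrence bound `k` one exponent `c`; size-`≤ s` formulas; the
characteristic hypothesis of Thm. 48 (`char = 0` or `> s^R`), not restated in Thm. 9, is carried
with the exponent `R` existential in `(D, k)` (see the ERRATUM below); `log = ⌈log₂⌉` as in the
typed Construction 46; infinite field.
ERRATUM / provenance (D13, safe reading, lead-np ruling (33); PRINT-ERRATA B23): print fixes
`R = (2k)^{2D·2^D}`, which is [ASSS16]'s constant for the top-fan-in-`≤ k` reduced class; for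
size-`s` depth-`D` occur-`k` formulas the printed proofs ([ASSS16] §4 + FSV Cor. 49) give a larger
`R′(k, D)` (reduction: depth `D+1`, occur `2k`, size `s²+s`); `R` is kept existential in `(D, k)`.
Equal to print in characteristic `0` up to the value of `R`; weaker otherwise; `FSV2018_thm9`
inherits this reading of its occur conjunct. (The first landed text had `asssR k D` for `R`; the
only consumer, `FSV2018_thm9_occur_of_cor49` in `FSV18Thm9Assembly.lean`, is shape-agnostic since
p456871.) PROVENANCE CAVEAT B23 (see `FSV2018_thm48`, B21/B23): the verbatim threshold
`s^{(2k)^{2D·2^D}}` is not literally covered by [ASSS16]'s printed proof for the full occur class;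
characteristic `0` is unaffected.
[cite: ForbesShpilkaVolk2018, Thm. 9 (seq.) = ToC Thm. 1.10, p. 15, bullet 6; Cor. 49 = ToC Cor. 5.25]
locator: paper:arxiv-1701.05328 p0011.txt:L14; paper:doi-10-4086-toc-2018-v014a018 p0015.txt:L7 -/
def FSV2018_thm9_occur : Prop :=
  ∀ D k : ℕ, ∃ c R : ℕ, ∀ (F : Type) [Field F] [Infinite F] (n s : ℕ),
    (ringChar F = 0 ∨ s ^ R < ringChar F) →
      MultilinearSPSHits F n ((Nat.clog 2 s + n + 2) ^ c) (occurClass F (multilinearMonomials n) D k s)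

/-- **FSV Thm. 9 (ToC Thm. 1.10), bullet "Arbitrary circuits composed with sparse polynomials of
transcendence degree `O(1)`" (§6) — NAMED FACT.** For every transcendence degree bound `r` one
exponent `c`; class `sparseTrdegClass _ r s d`; the characteristic hypothesis of Fact 51 / Lemma 52
is carried in its corrected STRICT form `char = 0` or `> d^r` (ERRATUM found by val-lit t21: the
printed `≥` fails for the Jacobian criterion at `char = d^r`); infinite field. (The §6 lemmas Def. 50–Cor. 54 are the §6–8
seat's; only the summary bullet is typed here.)
[cite: ForbesShpilkaVolk2018, Thm. 9 (seq.) = ToC Thm. 1.10, p. 15, bullet 7; Cor. 54 = ToC Cor. 6.5]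
locator: paper:arxiv-1701.05328 p0011.txt:L16; paper:doi-10-4086-toc-2018-v014a018 p0015.txt:L8 -/
def FSV2018_thm9_sparseTrdeg : Prop :=
  ∀ r : ℕ, ∃ c : ℕ, ∀ (F : Type) [Field F] [Infinite F] (n s d : ℕ),
    (ringChar F = 0 ∨ d ^ r < ringChar F) →
      MultilinearSPSHits F n ((Nat.log 2 s + n + 2) ^ c) (sparseTrdegClass F (multilinearMonomials n) r s d)

/-- **FSV Thm. 9 (ToC Thm. 1.10) AS PRINTED — the conjunction of its seven bullets (LOAD-BEARING
decl of the val-lit NP corpus, `FSV2018_thm9`).** "In the space of multilinear polynomials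
`𝔽[x_1,…,x_n]^{1}_{ideg}`, the set of `poly(log s, n)`-size multilinear `ΣΠΣ` formulas is a
succinct hitting set for `N = 2^n`-variate size-`s` computations of the form • `Σ^{O(1)}ΠΣ`
formulas (§4.1) • `ΣΠΣ` formulas of transcendence degree `≤ O(1)` (§4.2) • Sparse polynomials
(§5.1) • `Σm∧ΣΠ^{O(1)}`-formulas (§5.2) • Commutative roABPs (§5.3) • Depth-`O(1)` Occur-`O(1)`
formulas (§5.4) • Arbitrary circuits composed with sparse polynomials of transcendence degree
`O(1)` (§6)." Honest framing: unconditional evidence for the algebraic natural proofs barrier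
against RESTRICTED distinguisher classes in the MULTILINEAR frame; it says nothing about the tree's
crux `SuccinctHittingSetsForVP` (all `poly(N)`-size distinguishers, regime `d = n`), which is open.
[cite: ForbesShpilkaVolk2018, Thm. 9 (seq.) = ToC Thm. 1.10, pp. 14–15]
locator: paper:arxiv-1701.05328 p0011.txt:L1; paper:doi-10-4086-toc-2018-v014a018 p0014.txt:L42 -/
def FSV2018_thm9 : Prop :=
  FSV2018_thm9_spsk ∧ FSV2018_thm9_trdeg ∧ FSV2018_thm9_sparse ∧ FSV2018_thm9_smesp ∧
    FSV2018_thm9_commROABP ∧ FSV2018_thm9_occur ∧ FSV2018_thm9_sparseTrdeg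

/-- **Thm. 9, sparse bullet, PROVED modulo the tree's Cor. 34 fact
`ForbesShpilkaVolk2018_svGeneratorHitsSparse`:** with `k = ⌊log₂ s⌋ + 1` seed blocks (`s < 2^k`),
the shifted SV generator hits the `s`-sparse distinguishers and is `roProductSums n (k+1)`-succinct
(`isSuccinctGenerator_svGenCoeff`); `(k+1)(n+2) ≤ (⌊log₂ s⌋ + n + 2)²`.
[cite: ForbesShpilkaVolk2018, Thm. 9 and Cor. 34 (seq.) = ToC Thm. 1.10 and Cor. 5.10, pp. 15, 26]
locator: paper:doi-10-4086-toc-2018-v014a018 p0026.txt:L27 -/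
theorem FSV2018_thm9_sparse_of_svGeneratorHitsSparse
    (h : ∀ (F : Type) [Field F], ForbesShpilkaVolk2018_svGeneratorHitsSparse F) :
    FSV2018_thm9_sparse := by
  refine ⟨2, fun F _ _ n s => ?_⟩
  have hgen : IsHittingSetGenerator {D : MvPolynomial (multilinearMonomials n) F | D.support.card ≤ s}
      (fun m : multilinearMonomials n => svGenCoeff F n (Nat.log 2 s + 1) (m : Fin n →₀ ℕ)) := by
    intro D hD hD0
    refine h F n (Nat.log 2 s + 1) D hD0 (le_of_lt (lt_of_le_of_lt hD ?_))
    exact Nat.lt_pow_succ_log_self Nat.one_lt_two s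
  refine multilinearSPSHits_of_generator hgen (isSuccinctGenerator_svGenCoeff _) ?_
  nlinarith [Nat.zero_le (Nat.log 2 s), Nat.zero_le n]

/-- **Thm. 9, `Σ^{O(1)}ΠΣ` bullet, PROVED modulo Cor. 22** (hence modulo Fact 19, by
`FSV2018_cor22_of_fact19`). [cite: ForbesShpilkaVolk2018, Thm. 9 and Cor. 22 (seq.) = ToC Thm. 1.10 and Cor. 4.7]
locator: paper:doi-10-4086-toc-2018-v014a018 p0022.txt:L19 -/
theorem FSV2018_thm9_spsk_of_cor22 (h : FSV2018_cor22) : FSV2018_thm9_spsk := by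
  obtain ⟨c, hc⟩ := h
  intro k
  refine ⟨c * k ^ 2 + 3, fun F _ _ n s => ?_⟩
  obtain ⟨hgen, hsucc⟩ := hc F n k s
  refine multilinearSPSHits_of_generator hgen hsucc ?_
  set L := Nat.log 2 s + n + 2 with hL
  have hL2 : 2 ≤ L := by omega
  have h1 : c * k ^ 2 * (Nat.log 2 s + 1) + 1 ≤ (c * k ^ 2 + 1) * L :=
    calc c * k ^ 2 * (Nat.log 2 s + 1) + 1
        ≤ c * k ^ 2 * (Nat.log 2 s + 1) + 1 + (c * k ^ 2 * (n + 1) + Nat.log 2 s + n + 1) :=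
          Nat.le_add_right _ _
      _ = (c * k ^ 2 + 1) * L := by rw [hL]; ring
  have h2 : n + 2 ≤ L := by omega
  have h3 : c * k ^ 2 + 1 ≤ L ^ (c * k ^ 2 + 1) :=
    (Nat.lt_two_pow_self).le.trans (Nat.pow_le_pow_left hL2 _)
  calc (c * k ^ 2 * (Nat.log 2 s + 1) + 1) * (n + 2)
      ≤ ((c * k ^ 2 + 1) * L) * L := Nat.mul_le_mul h1 h2
    _ ≤ (L ^ (c * k ^ 2 + 1) * L) * L := by gcongr
    _ = L ^ (c * k ^ 2 + 3) := by ring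

/-- **Thm. 37 PROVED modulo Lemma 36 and Lemma 31** (print: "consider the generator
`G^{SSSV}_{n, C log s}` … By Fact 30, this generator is `poly(log s, n)`-`ΣΠΣ` succinct. By Lemma 36
and Lemma 31, it follows that [it] hits this class"): `k = c·(⌊log₂ s⌋ + 1)` seed blocks, shift by
the full-support vector `𝟙`. [cite: ForbesShpilkaVolk2018, Thm. 37 (seq.) = ToC Thm. 5.13, p. 27]
locator: paper:doi-10-4086-toc-2018-v014a018 p0027.txt:L2 -/
theorem FSV2018_thm37_of_lemma36_of_lemma31 (h36 : FSV2018_lemma36) (h31 : FSV2018_lemma31) :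
    FSV2018_thm37 := by
  intro t
  obtain ⟨c, hc⟩ := h36 t
  refine ⟨c + 2, fun F _ n s => ?_⟩
  refine ⟨Fin (c * (Nat.log 2 s + 1)) ⊕ (Fin (c * (Nat.log 2 s + 1)) × Fin n), inferInstance,
    fun m => svGenCoeff F n (c * (Nat.log 2 s + 1)) (m : Fin n →₀ ℕ), ?_, ?_⟩
  · intro D hD hD0
    refine h31 F n _ D hD0 ?_
    obtain ⟨m, hm, hmk⟩ :=
      hc F (multilinearMonomials n) D s hD.1 hD0 hD.2 (fun _ => 1) (fun _ => one_ne_zero)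
    exact ⟨m, by simpa using hm, hmk⟩
  · refine (isSuccinctGenerator_svGenCoeff (F := F) (n := n) _).mono (roProductSums_mono ?_)
    have hL : 2 ≤ Nat.log 2 s + 2 := by omega
    calc c * (Nat.log 2 s + 1) + 1
        ≤ (c + 1) * (Nat.log 2 s + 2) := by nlinarith
      _ ≤ (Nat.log 2 s + 2) ^ (c + 1) * (Nat.log 2 s + 2) := by
          gcongr
          exact (Nat.lt_two_pow_self).le.trans (Nat.pow_le_pow_left hL _)
      _ = (Nat.log 2 s + 2) ^ (c + 2) := by ring

/-- **Thm. 9, transcendence-degree bullet, PROVED modulo Thm. 24** (hence modulo Lemma 23).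
[cite: ForbesShpilkaVolk2018, Thm. 9 and Thm. 24 (seq.) = ToC Thm. 1.10 and Thm. 4.9]
locator: paper:doi-10-4086-toc-2018-v014a018 p0023.txt:L2 -/
theorem FSV2018_thm9_trdeg_of_thm24 (h : FSV2018_thm24) : FSV2018_thm9_trdeg := by
  obtain ⟨c, hc⟩ := h
  intro k
  refine ⟨(k + 2) * c + 1, fun F _ _ n d hchar => ?_⟩
  obtain ⟨τ, _, G, hgen, hsucc⟩ := hc F n k d hchar
  refine multilinearSPSHits_of_generator hgen hsucc ?_
  have h2 : 2 ≤ n + 2 := by omega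
  calc (k + 2) ^ c * (n + 2) ≤ (2 ^ (k + 2)) ^ c * (n + 2) := by
        gcongr; exact (Nat.lt_two_pow_self).le
    _ ≤ ((n + 2) ^ (k + 2)) ^ c * (n + 2) := by gcongr
    _ = (n + 2) ^ ((k + 2) * c + 1) := by rw [← pow_mul]; ring

/-- **Thm. 9, `Σm∧ΣΠ^{O(1)}` bullet, PROVED modulo Thm. 37.**
[cite: ForbesShpilkaVolk2018, Thm. 9 and Thm. 37 (seq.) = ToC Thm. 1.10 and Thm. 5.13]
locator: paper:doi-10-4086-toc-2018-v014a018 p0027.txt:L2 -/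
theorem FSV2018_thm9_smesp_of_thm37 (h : FSV2018_thm37) : FSV2018_thm9_smesp := by
  intro t
  obtain ⟨c, hc⟩ := h t
  refine ⟨c + 1, fun F _ _ n s => ?_⟩
  obtain ⟨τ, _, G, hgen, hsucc⟩ := hc F n s
  refine multilinearSPSHits_of_generator hgen hsucc ?_
  calc (Nat.log 2 s + 2) ^ c * (n + 2)
      ≤ (Nat.log 2 s + n + 2) ^ c * (Nat.log 2 s + n + 2) :=
        Nat.mul_le_mul (Nat.pow_le_pow_left (by omega) _) (by omega)
    _ = (Nat.log 2 s + n + 2) ^ (c + 1) := by ring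

/-- **Thm. 9, commutative-roABP bullet, PROVED modulo Cor. 44** (hence modulo Thm. 43); the field
being infinite supplies Thm. 43's `|𝔽| > nd`. [cite: ForbesShpilkaVolk2018, Thm. 9 and Cor. 44 (seq.) = ToC Thm. 1.10 and Cor. 5.20]
locator: paper:doi-10-4086-toc-2018-v014a018 p0029.txt:L14 -/
theorem FSV2018_thm9_commROABP_of_cor44 (h : FSV2018_cor44) : FSV2018_thm9_commROABP := by
  obtain ⟨c, hc⟩ := h
  refine ⟨c + 1, fun F _ _ n w d => ?_⟩
  obtain ⟨S, hS⟩ := Infinite.exists_subset_card_eq F (n * d + 1)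
  obtain ⟨τ, _, G, hgen, hsucc⟩ := hc F n d w ⟨S, by omega⟩
  refine multilinearSPSHits_of_generator hgen hsucc ?_
  calc (Nat.clog 2 w + 2) ^ c * (n + 2)
      ≤ (Nat.clog 2 w + n + 2) ^ c * (Nat.clog 2 w + n + 2) :=
        Nat.mul_le_mul (Nat.pow_le_pow_left (by omega) _) (by omega)
    _ = (Nat.clog 2 w + n + 2) ^ (c + 1) := by ring

/-! ### Thm. 10 (ToC Thm. 1.11): width-`w²` roABPs fool width-`w` roABPs in monomial-compatible orders -/

section MonomialCompatible

variable {n N : ℕ}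

/-- **Monomial-compatible orderings (§7.1):** an ordering `π` of the `N = 2^n` multilinear monomials
(= the variables `X_1, …, X_N`) is monomial compatible if it is "the lexicographic ordering induced on
the set of multilinear monomials in `{x_1, …, x_n}` by [some] order `σ`" of the `n` variables: `π`
is strictly increasing for the lexicographic order of the exponent vectors read in the priority
order `σ`. [cite: ForbesShpilkaVolk2018, §7.1 (seq. p. 24) = ToC §7.1, p. 34]
locator: paper:arxiv-1701.05328 p0024.txt:L1; paper:doi-10-4086-toc-2018-v014a018 p0034.txt:L1 -/
def IsMonomialCompatible (π : Fin N ≃ multilinearMonomials n) : Prop :=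
  ∃ σ : Equiv.Perm (Fin n), ∀ a b : Fin N, a < b ↔
    toLex (fun i : Fin n => (π a : Fin n →₀ ℕ) (σ i)) < toLex (fun i : Fin n => (π b : Fin n →₀ ℕ) (σ i))

end MonomialCompatible

/-- **FSV Thm. 10 (ToC Thm. 1.11; §7, Cor. 60 = ToC Cor. 7.6) — NAMED FACT.** "In the space of
multilinear polynomials `𝔽[x_1,…,x_n]^{1}_{ideg}`, the set of width-`w²` length-`n` roABPs is a
succinct hitting set for width-`w` and length-`N = 2^n` roABPs with a monomial compatible ordering of
the variables." Rendering: hitting set = multilinear polynomials in `x_1, …, x_n` computed by a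
width-`w²` roABP in SOME order of the `n` variables (any individual degree of the edge labels);
distinguishers = `N`-variate polynomials of individual degree `≤ d` computed by a width-`w` roABP in
a monomial-compatible order `π`; infinite field (the Forbes–Shpilka generator of Lemma 55 needs an
element of multiplicative order `≥ (N d w²)²`, and hitting SETS need a large field); `0 < n`
(CORRECTION 2026-08-26, kernel counterexample by val-lit t21: at `n = 0` the `x`-side roABPs of
the `(1,1)`-entry normal form `IsROABP` have no layer and compute only the constant `1`, which the
one-layer distinguisher `c_∅ - 1` annihilates; print's length-`n` programs presuppose `n ≥ 1`, as
does the whole paper, §3 "let `n, s ≥ 1`"). The §7 lemmas (Lemma 55–Cor. 60) are typed by the §6–8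
seat (`FSV2018ROABP.lean`, with the same `0 < n` guard).
[cite: ForbesShpilkaVolk2018, Thm. 10 (seq.) = ToC Thm. 1.11, p. 15]
locator: paper:arxiv-1701.05328 p0011.txt:L20; paper:doi-10-4086-toc-2018-v014a018 p0015.txt:L14 -/
def FSV2018_thm10 : Prop :=
  ∀ (F : Type) [Field F] [Infinite F] (n w d : ℕ) (π : Fin (2 ^ n) ≃ multilinearMonomials n),
    0 < n → IsMonomialCompatible π →
      IsSuccinctHittingSet (multilinearMonomials n)
        {f : MvPolynomial (Fin n) F | (∀ m ∈ f.support, m ∈ multilinearMonomials n) ∧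
          ∃ (ρ : Fin n ≃ Fin n) (d' : ℕ), IsROABP F (w ^ 2) d' ρ f}
        {D : MvPolynomial (multilinearMonomials n) F |
          (∀ m ∈ D.support, ∀ v, m v ≤ d) ∧ IsROABP F w d π D}

/-! ### Cor. 11 (ToC Cor. 1.12): equations for `VP` are hard for the models of Thm. 9 -/

/-- **FSV Cor. 11 (ToC Cor. 1.12), its logical content (PROVED schema):** "Let `𝒯` be the set of
defining equations for `VP`. For each of the models mentioned in Thm. 9, there exists a polynomial
`P ∈ 𝒯` which requires super-polynomial size when computed in this model." By FSV Thm. 4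
(`exists_isNaturalProof_iff`) a bullet of Thm. 9 says exactly: NO nonzero member of the model class
`𝒟` vanishes on (the coefficient vectors of) all multilinear `ΣΠΣ` formulas of size `≤ S` — and those
formulas are `poly(S, n)`-size, degree-`≤ n` algebraic circuits (for the explicit read-once product
sums: `complexity_affineProductSum_le`, `affineProductSum_mem_smallCircuits`), i.e. lie in `VP`;
hence every defining equation of (any class containing) them lies outside `𝒟`, i.e. "requires
super-polynomial size" in that model once `S = poly(log s, n)`. Typed as the schema, for any `𝒟`
and `S`; instantiate with the bullets `FSV2018_thm9_*`.
[cite: ForbesShpilkaVolk2018, Cor. 11 (seq.) = ToC Cor. 1.12, p. 17]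
locator: paper:arxiv-1701.05328 p0012.txt:L9; paper:doi-10-4086-toc-2018-v014a018 p0017.txt:L19 -/
theorem FSV2018_cor11_of_hits {F : Type*} [Field F] {n S : ℕ}
    {𝒟 : Set (MvPolynomial (multilinearMonomials n) F)} (h : MultilinearSPSHits F n S 𝒟) :
    ¬ ∃ D, IsNaturalProof (multilinearMonomials n) (multilinearSPS F n S) 𝒟 D :=
  fun hD => (exists_isNaturalProof_iff _ _ _).1 hD h


/-! ## Discharge pass: Lemma 28 (planting) proved -/

section Lemma28Proof

variable {F : Type*} [Field F] {n k : ℕ}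

/-- Substituting constants `β` for the `z`-seeds and polynomials `g_j` for the `y`-seeds in
`G^{SSV}_{n,k}`: coordinate `m` becomes `∑_j g_j · ∏_i (m_i = 0 ? 1 - β_{j,i} : β_{j,i})`.
[cite: ForbesShpilkaVolk2018, Lemma 28 (seq.) = ToC Lemma 5.4, p. 24 (proof)] -/
private theorem bind₁_ssvGenCoeff_const {τ : Type*} (g : Fin k → MvPolynomial τ F)
    (β : Fin k × Fin n → F) (m : Fin n →₀ ℕ) :
    bind₁ (Sum.elim g fun p => C (β p)) (ssvGenCoeff F n k m) =
      ∑ j : Fin k, g j * C (∏ i : Fin n, (if m i = 0 then 1 - β (j, i) else β (j, i))) := by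
  rw [ssvGenCoeff, map_sum]
  refine Finset.sum_congr rfl fun j _ => ?_
  rw [map_mul, bind₁_X_right, Sum.elim_inl, map_prod, map_prod]
  congr 1
  refine Finset.prod_congr rfl fun i _ => ?_
  split_ifs <;> simp [bind₁_X_right]

/-- With `z_j = 𝟙_{S_j}` (the indicator of `supp t`), the factor product at coordinate `m` is
`[m = t]` for multilinear `m, t` ("`P(𝟙_{S_j}, x) = x_{S_j}`", proof of Lemma 28).
[cite: ForbesShpilkaVolk2018, Lemma 28 (seq.) = ToC Lemma 5.4, p. 24 (proof)] -/
private theorem prod_indicator_factor {m t : Fin n →₀ ℕ} (hm : m ∈ multilinearMonomials n)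
    (ht : t ∈ multilinearMonomials n) :
    (∏ i : Fin n, (if m i = 0 then 1 - (if t i = 0 then (0 : F) else 1)
      else (if t i = 0 then (0 : F) else 1))) = if m = t then 1 else 0 := by
  by_cases hmt : m = t
  · subst hmt
    rw [if_pos rfl]
    refine Finset.prod_eq_one fun i _ => ?_
    split_ifs <;> simp
  · rw [if_neg hmt]
    obtain ⟨i, hi⟩ : ∃ i, m i ≠ t i := by
      by_contra h
      push Not at h
      exact hmt (Finsupp.ext h)
    refine Finset.prod_eq_zero (Finset.mem_univ i) ?_
    have hm1 := hm i
    have ht1 := ht i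
    by_cases h0 : m i = 0
    · have : t i ≠ 0 := fun h' => hi (by rw [h0, h'])
      rw [if_pos h0, if_neg this, sub_self]
    · have : t i = 0 := by omega
      rw [if_neg h0, if_pos this]

/-- **FSV Lemma 28 (ToC Lemma 5.4) PROVED — discharge of `FSV2018_lemma28`.** As in print: inject
`T` into the seed indices (`|T| ≤ k`), set `z_j = 𝟙_{S_j}` for the seed index `j` assigned to
`x_{S_j} ∈ T`, keep those `y_j` and zero the others; then coordinate `m` of `G^{SSV}_{n,k}` is
`y_{e(m)}` for `m ∈ T` and `0` otherwise. [cite: ForbesShpilkaVolk2018, Lemma 28 (seq.) = ToC Lemma 5.4, p. 24] -/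
theorem FSV2018_lemma28_holds : FSV2018_lemma28 := by
  intro F _ n k T hT
  classical
  -- the injection of `T` into the seed indices
  let e : T → Fin k := fun t => Fin.castLE hT (T.equivFin t)
  have he : Function.Injective e := fun t t' h =>
    T.equivFin.injective (Fin.castLE_injective hT h)
  -- keep exactly the planted `y`'s; `z_{e t, i} = [t_i ≠ 0]`
  let keep : Fin k → Bool := fun j => decide (∃ t, e t = j)
  let β : Fin k × Fin n → F := fun p =>
    if h : ∃ t, e t = p.1 then
      (if ((h.choose : T) : multilinearMonomials n).1 p.2 = 0 then 0 else 1)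
    else 0
  refine ⟨β, keep, e, he, fun m => ?_⟩
  have hβ : ∀ (t : T) (i : Fin n),
      β (e t, i) = if ((t : multilinearMonomials n) : Fin n →₀ ℕ) i = 0 then 0 else 1 := by
    intro t i
    have hex : ∃ t', e t' = e t := ⟨t, rfl⟩
    have hch : hex.choose = t := he hex.choose_spec
    show (if h : ∃ t', e t' = e t then
      (if ((h.choose : T) : multilinearMonomials n).1 i = 0 then (0 : F) else 1) else 0) = _
    rw [dif_pos hex, hch]
  rw [bind₁_ssvGenCoeff_const]
  -- each summand, rewritten as a sum over `T`
  have hterm : ∀ j : Fin k,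
      (if keep j then (X j : MvPolynomial (Fin k) F) else 0) *
          C (∏ i : Fin n, (if (m : Fin n →₀ ℕ) i = 0 then 1 - β (j, i) else β (j, i))) =
        ∑ t : T, if e t = j then
          (if ((t : multilinearMonomials n) : Fin n →₀ ℕ) = (m : Fin n →₀ ℕ) then
            (X j : MvPolynomial (Fin k) F) else 0)
          else 0 := by
    intro j
    by_cases hj : ∃ t, e t = j
    · obtain ⟨t, rfl⟩ := hj
      rw [Finset.sum_eq_single t]
      · rw [if_pos rfl]
        have hk : keep (e t) = true := by
          simp only [keep, decide_eq_true_eq]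
          exact ⟨t, rfl⟩
        rw [if_pos hk]
        simp_rw [hβ t]
        rw [prod_indicator_factor m.2 t.1.2]
        by_cases hmt : ((m : multilinearMonomials n) : Fin n →₀ ℕ) =
            ((t : multilinearMonomials n) : Fin n →₀ ℕ)
        · rw [if_pos hmt, if_pos hmt.symm, map_one, mul_one]
        · rw [if_neg hmt, if_neg (Ne.symm hmt), map_zero, mul_zero]
      · intro t' _ ht'
        rw [if_neg (fun h => ht' (he h))]
      · intro h
        exact absurd (Finset.mem_univ t) h
    · have hk : keep j = false := by
        simp only [keep, decide_eq_false_iff_not]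
        exact hj
      rw [hk]
      simp only [Bool.false_eq_true, if_false, zero_mul]
      symm
      refine Finset.sum_eq_zero fun t _ => ?_
      rw [if_neg (fun h => hj ⟨t, h⟩)]
  rw [Finset.sum_congr rfl fun j _ => hterm j, Finset.sum_comm]
  simp only [Finset.sum_ite_eq, Finset.mem_univ, if_true]
  by_cases hm : m ∈ T
  · rw [dif_pos hm, Finset.sum_eq_single (⟨m, hm⟩ : T)]
    · rw [if_pos rfl]
    · intro t _ ht
      rw [if_neg]
      intro h
      exact ht (Subtype.ext (Subtype.ext h))
    · intro h
      exact absurd (Finset.mem_univ _) h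
  · rw [dif_neg hm]
    refine Finset.sum_eq_zero fun t _ => ?_
    rw [if_neg]
    intro h
    exact hm (by rw [← Subtype.ext h]; exact t.2)

end Lemma28Proof


section Lemma31Proof

variable {F : Type*} [Field F]

/-- Killing the variables outside `S` (`X_v ↦ X_v` for `v ∈ S`, `X_v ↦ 0` otherwise) keeps the
coefficient of every monomial supported inside `S` ("zero out all the remaining variables",
proof of Lemma 31). [cite: ForbesShpilkaVolk2018, Lemma 31 (seq.) = ToC Lemma 5.7, p. 25 (proof)] -/
private theorem coeff_bind₁_kill {σ : Type*} [DecidableEq σ] (S : Finset σ) (G : MvPolynomial σ F)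
    (d : σ →₀ ℕ) (hd : d.support ⊆ S) :
    coeff d (bind₁ (fun v => if v ∈ S then (X v : MvPolynomial σ F) else 0) G) = coeff d G := by
  induction G using MvPolynomial.induction_on' with
  | monomial u a =>
    rw [bind₁_monomial]
    by_cases hu : u.support ⊆ S
    · have : (∏ i ∈ u.support, ((if i ∈ S then (X i : MvPolynomial σ F) else 0) ^ u i)) =
          ∏ i ∈ u.support, (X i : MvPolynomial σ F) ^ u i :=
        Finset.prod_congr rfl fun i hi => by rw [if_pos (hu hi)]
      rw [this, monomial_eq, Finsupp.prod]
    · obtain ⟨i, hi, hiS⟩ := Finset.not_subset.1 hu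
      have hzero : (∏ i ∈ u.support, ((if i ∈ S then (X i : MvPolynomial σ F) else 0) ^ u i)) = 0 := by
        refine Finset.prod_eq_zero hi ?_
        rw [if_neg hiS, zero_pow (Finsupp.mem_support_iff.1 hi)]
      rw [hzero, mul_zero, coeff_zero, coeff_monomial, if_neg]
      rintro rfl
      exact hu hd
  | add p q hp hq => rw [map_add, coeff_add, coeff_add, hp, hq]

/-- **FSV Lemma 31 (ToC Lemma 5.7) PROVED — discharge of `FSV2018_lemma31`, from Lemma 28.** As in
print: `D ∘ G^{SSSV} = G ∘ G^{SSV}` for `G = D(X + 𝟙)`; plant free `y`'s on the variables of a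
monomial `M` of `G` of support `≤ k` and zero every other coordinate (Lemma 28); pulling the planted
`y`'s back to their coordinates turns this into the substitution killing the variables outside
`supp M`, under which the coefficient of `M` survives — so `G ∘ G^{SSV} ≠ 0`.
[cite: ForbesShpilkaVolk2018, Lemma 31 (seq.) = ToC Lemma 5.7, p. 25] -/
theorem FSV2018_lemma31_holds : FSV2018_lemma31 := by
  intro F _ n k D hD0 hmon
  obtain ⟨m₀, hm₀, hk⟩ := hmon
  classical
  -- `D ∘ G^{SSSV} = G ∘ G^{SSV}` with `G = D(X + 𝟙)`
  have hcomp : bind₁ (fun m : multilinearMonomials n => svGenCoeff F n k (m : Fin n →₀ ℕ)) D =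
      bind₁ (fun m : multilinearMonomials n => ssvGenCoeff F n k (m : Fin n →₀ ℕ))
        (aeval (fun v : multilinearMonomials n =>
          (X v + 1 : MvPolynomial (multilinearMonomials n) F)) D) := by
    have hfun : (fun m : multilinearMonomials n => svGenCoeff F n k (m : Fin n →₀ ℕ)) =
        fun v => bind₁ (fun m : multilinearMonomials n => ssvGenCoeff F n k (m : Fin n →₀ ℕ))
          ((X v + 1 : MvPolynomial (multilinearMonomials n) F)) := by
      funext v
      rw [map_add, map_one, bind₁_X_right, svGenCoeff_eq_ssvGenCoeff_add_one]
    rw [aeval_eq_bind₁, bind₁_bind₁, ← hfun]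
  rw [hcomp]
  set G := aeval (fun v : multilinearMonomials n =>
    (X v + 1 : MvPolynomial (multilinearMonomials n) F)) D with hG
  -- plant on `T := supp m₀` (Lemma 28)
  obtain ⟨β, keep, e, he, hplant⟩ := FSV2018_lemma28_holds F n k m₀.support hk
  intro hzero
  have h1 := congrArg (bind₁ (Sum.elim (fun j => if keep j then (X j : MvPolynomial (Fin k) F) else 0)
    (fun p => C (β p)))) hzero
  rw [map_zero, bind₁_bind₁] at h1
  simp_rw [hplant] at h1
  -- pull the planted `y`'s back to their coordinates
  let θ : Fin k → MvPolynomial (multilinearMonomials n) F := fun j =>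
    if h : ∃ t : m₀.support, e t = j then X (h.choose : multilinearMonomials n) else 0
  have h2 := congrArg (bind₁ θ) h1
  rw [map_zero, bind₁_bind₁] at h2
  have hkill : (fun v : multilinearMonomials n =>
      bind₁ θ (if h : v ∈ m₀.support then (X (e ⟨v, h⟩) : MvPolynomial (Fin k) F) else 0)) =
      fun v => if v ∈ m₀.support then (X v : MvPolynomial (multilinearMonomials n) F) else 0 := by
    funext v
    by_cases hv : v ∈ m₀.support
    · rw [dif_pos hv, if_pos hv, bind₁_X_right]
      have hex : ∃ t : m₀.support, e t = e ⟨v, hv⟩ := ⟨⟨v, hv⟩, rfl⟩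
      have hch : (hex.choose : multilinearMonomials n) = v :=
        congrArg Subtype.val (he hex.choose_spec)
      show (if h : ∃ t : m₀.support, e t = e ⟨v, hv⟩ then
        (X (h.choose : multilinearMonomials n) : MvPolynomial (multilinearMonomials n) F) else 0) = X v
      rw [dif_pos hex, hch]
    · rw [dif_neg hv, if_neg hv, map_zero]
  rw [hkill] at h2
  -- the monomial `m₀` survives
  have h3 := congrArg (coeff m₀) h2
  rw [coeff_bind₁_kill _ _ _ (Finset.Subset.refl _), coeff_zero] at h3
  exact (mem_support_iff.1 hm₀) h3

end Lemma31Proof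

/-- **Thm. 37 PROVED modulo Lemma 36 alone** (Lemma 31 being discharged above).
[cite: ForbesShpilkaVolk2018, Thm. 37 (seq.) = ToC Thm. 5.13, p. 27]
locator: paper:doi-10-4086-toc-2018-v014a018 p0027.txt:L2 -/
theorem FSV2018_thm37_of_lemma36 (h36 : FSV2018_lemma36) : FSV2018_thm37 :=
  FSV2018_thm37_of_lemma36_of_lemma31 h36 FSV2018_lemma31_holds


/-! ## Discharge pass: Lemma 33 (Oliveira's product-sparsity lemma, corrected form) proved -/

section Lemma33Proof

variable {F : Type*} [Field F] {σ : Type*}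

/-- Coefficients of the `X_i`-degree-`j` slice of `H` (weight `𝟙_i`).
[cite: ForbesShpilkaVolk2018, Lemma 33 (seq.) = ToC Lemma 5.9, p. 26 (proof by induction)] -/
private theorem coeff_slice [DecidableEq σ] (i : σ) (j : ℕ) (H : MvPolynomial σ F) (m : σ →₀ ℕ) :
    coeff m (weightedHomogeneousComponent (Pi.single i 1) j H) =
      if m i = j then coeff m H else 0 := by
  rw [coeff_weightedHomogeneousComponent, Finsupp.weight_single_one_apply]

/-- Support of a slice. [folklore] -/
private theorem mem_support_slice [DecidableEq σ] {i : σ} {j : ℕ} {H : MvPolynomial σ F}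
    {m : σ →₀ ℕ} :
    m ∈ (weightedHomogeneousComponent (Pi.single i 1) j H).support ↔ m i = j ∧ m ∈ H.support := by
  rw [mem_support_iff, mem_support_iff, coeff_slice]
  split_ifs with h
  · exact (and_iff_right h).symm
  · simp [h]

/-- The slice through a monomial of `H` is nonzero. [folklore] -/
private theorem slice_ne_zero [DecidableEq σ] (i : σ) {H : MvPolynomial σ F} {m : σ →₀ ℕ}
    (hm : m ∈ H.support) : weightedHomogeneousComponent (Pi.single i 1) (m i) H ≠ 0 := by
  intro h0
  have h := coeff_slice i (m i) H m
  rw [h0, coeff_zero, if_pos rfl] at h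
  exact mem_support_iff.mp hm h.symm

/-- If `R` does not involve `X_i`, the `X_i`-degrees of the monomials of `R * G` are `X_i`-degrees
of monomials of `G`. [folklore] -/
private theorem apply_of_mem_support_mul {i : σ} {R G : MvPolynomial σ F}
    (hR : ∀ u ∈ R.support, u i = 0) {p : ℕ → Prop} (hG : ∀ v ∈ G.support, p (v i))
    {m : σ →₀ ℕ} (hm : m ∈ (R * G).support) : p (m i) := by
  classical
  obtain ⟨u, hu, v, hv, rfl⟩ := Finset.mem_add.mp (support_mul R G hm)
  rw [Finsupp.add_apply, hR u hu, zero_add]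
  exact hG v hv

/-- If `R` does not involve `X_i`, the coefficient of `m` in `R * H` only sees the slice of `H` of
`X_i`-degree `m i`. [folklore] -/
private theorem coeff_mul_eq_coeff_mul_slice [DecidableEq σ] {i : σ} {R : MvPolynomial σ F}
    (hR : ∀ u ∈ R.support, u i = 0) (H : MvPolynomial σ F) (m : σ →₀ ℕ) :
    coeff m (R * H) = coeff m (R * weightedHomogeneousComponent (Pi.single i 1) (m i) H) := by
  have hrest : coeff m (R * (H - weightedHomogeneousComponent (Pi.single i 1) (m i) H)) = 0 := by
    by_contra h
    have key : ∀ v ∈ (H - weightedHomogeneousComponent (Pi.single i 1) (m i) H).support,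
        ¬ v i = m i := by
      intro v hv hvi
      rw [mem_support_iff, coeff_sub, coeff_slice, if_pos hvi, sub_self] at hv
      exact hv rfl
    exact absurd rfl (apply_of_mem_support_mul hR (p := fun k => ¬ k = m i) key
      (mem_support_iff.mpr h))
  calc coeff m (R * H)
      = coeff m (R * weightedHomogeneousComponent (Pi.single i 1) (m i) H +
          R * (H - weightedHomogeneousComponent (Pi.single i 1) (m i) H)) := by
        rw [← mul_add, add_sub_cancel]
    _ = coeff m (R * weightedHomogeneousComponent (Pi.single i 1) (m i) H) := by
        rw [coeff_add, hrest, add_zero]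

/-- **The inductive step of Oliveira's lemma.** For `P = X_i · P₁ + P₀` with `P₀, P₁` free of `X_i`
and `Q ≠ 0` with `X_i`-degrees in `[d₀, D]` attained by the slices `Q_{d₀}`, `Q_D`: the monomials
of `P₁ · Q_D` shifted by `X_i` and the monomials of `P₀ · Q_{d₀}` lie in the support of `P · Q`,
disjointly. [cite: ForbesShpilkaVolk2018, Lemma 33 (seq.) = ToC Lemma 5.9, p. 26 (proof by induction)] -/
private theorem card_add_card_le_card_support_mul [DecidableEq σ] (i : σ)
    {P₀ P₁ Q : MvPolynomial σ F} (hP₀ : ∀ u ∈ P₀.support, u i = 0)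
    (hP₁ : ∀ u ∈ P₁.support, u i = 0) {d₀ D : ℕ} (hlow : ∀ m ∈ Q.support, d₀ ≤ m i)
    (hhigh : ∀ m ∈ Q.support, m i ≤ D) :
    (P₁ * weightedHomogeneousComponent (Pi.single i 1) D Q).support.card +
        (P₀ * weightedHomogeneousComponent (Pi.single i 1) d₀ Q).support.card ≤
      ((X i * P₁ + P₀) * Q).support.card := by
  set QD := weightedHomogeneousComponent (Pi.single i 1) D Q with hQD
  set Qd := weightedHomogeneousComponent (Pi.single i 1) d₀ Q with hQd
  have hdegT : ∀ m ∈ (P₁ * QD).support, m i = D := fun m hm =>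
    apply_of_mem_support_mul hP₁ (p := fun k => k = D) (fun v hv => (mem_support_slice.mp hv).1) hm
  have hdegB : ∀ m ∈ (P₀ * Qd).support, m i = d₀ := fun m hm =>
    apply_of_mem_support_mul hP₀ (p := fun k => k = d₀) (fun v hv => (mem_support_slice.mp hv).1) hm
  have hcoeff : ∀ m : σ →₀ ℕ, coeff m ((X i * P₁ + P₀) * Q) =
      (if i ∈ m.support then coeff (m - Finsupp.single i 1) (P₁ * Q) else 0) + coeff m (P₀ * Q) := by
    intro m
    rw [add_mul, coeff_add, mul_assoc, coeff_X_mul']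
  -- top: `m + e_i` for `m ∈ supp (P₁ QD)`
  have hT : (P₁ * QD).support.image (· + Finsupp.single i 1) ⊆ ((X i * P₁ + P₀) * Q).support := by
    intro m hm
    obtain ⟨m', hm', rfl⟩ := Finset.mem_image.mp hm
    have hmi := hdegT m' hm'
    rw [mem_support_iff, hcoeff]
    have him : i ∈ (m' + Finsupp.single i 1).support := by
      rw [Finsupp.mem_support_iff, Finsupp.add_apply, Finsupp.single_eq_same]; omega
    rw [if_pos him, add_tsub_cancel_right]
    have h0 : coeff (m' + Finsupp.single i 1) (P₀ * Q) = 0 := by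
      by_contra hne
      have h3 := apply_of_mem_support_mul hP₀ (p := fun k => k ≤ D) hhigh (mem_support_iff.mpr hne)
      simp only [Finsupp.add_apply, Finsupp.single_eq_same, hmi] at h3
      omega
    rw [h0, add_zero, coeff_mul_eq_coeff_mul_slice hP₁ Q m', hmi]
    exact mem_support_iff.mp hm'
  -- bottom: `m` for `m ∈ supp (P₀ Qd)`
  have hB : (P₀ * Qd).support ⊆ ((X i * P₁ + P₀) * Q).support := by
    intro m hm
    have hmi := hdegB m hm
    rw [mem_support_iff, hcoeff]
    have h1 : (if i ∈ m.support then coeff (m - Finsupp.single i 1) (P₁ * Q) else 0) = 0 := by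
      split_ifs with him
      · by_contra hne
        have h2 := apply_of_mem_support_mul hP₁ (p := fun k => d₀ ≤ k) hlow (mem_support_iff.mpr hne)
        simp only [Finsupp.tsub_apply, Finsupp.single_eq_same, hmi] at h2
        rw [Finsupp.mem_support_iff, hmi] at him
        omega
      · rfl
    rw [h1, zero_add, coeff_mul_eq_coeff_mul_slice hP₀ Q m, hmi]
    exact mem_support_iff.mp hm
  have hTB : Disjoint ((P₁ * QD).support.image (· + Finsupp.single i 1)) (P₀ * Qd).support := by
    rw [Finset.disjoint_left]
    intro m hmT hmB
    obtain ⟨m', hm', rfl⟩ := Finset.mem_image.mp hmT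
    have h1 := hdegB _ hmB
    rw [Finsupp.add_apply, Finsupp.single_eq_same, hdegT m' hm'] at h1
    have h2 : d₀ ≤ D := by
      obtain ⟨v, hv⟩ : (P₀ * Qd).support.Nonempty := ⟨_, hmB⟩
      have := hdegB v hv
      obtain ⟨u, hu, w, hw, rfl⟩ := Finset.mem_add.mp (support_mul P₀ Qd hv)
      have hw' := (mem_support_slice.mp hw).2
      exact (hlow w hw').trans (hhigh w hw')
    omega
  rw [← Finset.card_image_of_injective (P₁ * QD).support (add_left_injective (Finsupp.single i 1)),
    ← Finset.card_union_of_disjoint hTB]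
  exact Finset.card_le_card (Finset.union_subset hT hB)

/-- **FSV Lemma 33 (ToC Lemma 5.9) in its corrected form, PROVED — discharge of `FSV2018_lemma33`
(Oliveira; [FSTW16, Prop. 6.14]): a multilinear `P` times a nonzero `Q` has at least as many
monomials as `P`.** Induction on the number of variables of `P` ("can be proved by induction on
`N`"): write `P = X_i P₁ + P₀`, take the top and bottom `X_i`-slices `Q_D`, `Q_{d₀}` of `Q`; the
monomials of `P₁ Q_D` (shifted by `X_i`) and of `P₀ Q_{d₀}` survive in `P Q` disjointly, and by
induction they are at least `|supp P₁| + |supp P₀| = |supp P|` in number.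
[cite: ForbesShpilkaVolk2018, Lemma 33 (seq.) = ToC Lemma 5.9, p. 26] -/
theorem FSV2018_lemma33_holds : FSV2018_lemma33 := by
  intro F _ σ P Q hP hQ
  classical
  -- induction on the number of variables of `P`
  suffices h : ∀ (N : ℕ) (P : MvPolynomial σ F), P.vars.card ≤ N →
      (∀ m ∈ P.support, ∀ i, m i ≤ 1) → ∀ Q : MvPolynomial σ F, Q ≠ 0 →
        P.support.card ≤ (P * Q).support.card from h _ P le_rfl hP Q hQ
  intro N
  induction N with
  | zero =>
    intro P hN hP Q hQ
    -- `P` is a constant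
    have hvars : P.vars = ∅ := Finset.card_eq_zero.mp (Nat.le_zero.mp hN)
    have hsupp : P.support ⊆ {0} := by
      intro m hm
      rw [Finset.mem_singleton]
      ext i
      by_contra hi
      have : i ∈ P.vars := (mem_vars_iff_mem_support i).mpr ⟨m, hm, Finsupp.mem_support_iff.mpr hi⟩
      rw [hvars] at this
      exact absurd this (Finset.notMem_empty i)
    by_cases hP0 : P = 0
    · simp [hP0]
    · calc P.support.card ≤ ({0} : Finset (σ →₀ ℕ)).card := Finset.card_le_card hsupp
        _ = 1 := Finset.card_singleton _
        _ ≤ (P * Q).support.card := Finset.card_pos.mpr (support_nonempty.mpr (mul_ne_zero hP0 hQ))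
  | succ N ih =>
    intro P hN hP Q hQ
    by_cases hsmall : P.vars.card ≤ N
    · exact ih P hsmall hP Q hQ
    -- pick a variable `i` of `P`
    obtain ⟨i, hi⟩ : P.vars.Nonempty := Finset.card_pos.mp (by omega)
    set P₁ := P.divMonomial (Finsupp.single i 1) with hP₁
    set P₀ := P.modMonomial (Finsupp.single i 1) with hP₀
    have hdecomp : X i * P₁ + P₀ = P := divMonomial_add_modMonomial_single P i
    -- coefficients of the two parts
    have hcP₁ : ∀ m, coeff m P₁ = coeff (Finsupp.single i 1 + m) P := fun m => coeff_divMonomial _ _ _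
    have hcP₀ : ∀ m : σ →₀ ℕ, coeff m P₀ = if m i = 0 then coeff m P else 0 := by
      intro m
      by_cases hm : m i = 0
      · rw [if_pos hm, hP₀, coeff_modMonomial_of_not_le]
        rw [Finsupp.single_le_iff]; omega
      · rw [if_neg hm, hP₀, coeff_modMonomial_of_le]
        rw [Finsupp.single_le_iff]; omega
    -- both parts are free of `X_i` and multilinear, with fewer variables
    have hfree₁ : ∀ u ∈ P₁.support, u i = 0 := by
      intro u hu
      rw [mem_support_iff, hcP₁] at hu
      have := hP _ (mem_support_iff.mpr hu) i
      simp only [Finsupp.add_apply, Finsupp.single_eq_same] at this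
      omega
    have hfree₀ : ∀ u ∈ P₀.support, u i = 0 := by
      intro u hu
      rw [mem_support_iff, hcP₀] at hu
      by_contra h
      exact hu (if_neg h)
    have hml₁ : ∀ m ∈ P₁.support, ∀ j, m j ≤ 1 := by
      intro m hm j
      rw [mem_support_iff, hcP₁] at hm
      have := hP _ (mem_support_iff.mpr hm) j
      simp only [Finsupp.add_apply] at this
      omega
    have hml₀ : ∀ m ∈ P₀.support, ∀ j, m j ≤ 1 := by
      intro m hm j
      rw [mem_support_iff, hcP₀] at hm
      split_ifs at hm with h
      · exact hP _ (mem_support_iff.mpr hm) j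
      · exact absurd rfl hm
    have hvars_sub : ∀ (R : MvPolynomial σ F), (∀ u ∈ R.support, u i = 0) →
        (∀ m ∈ R.support, coeff m R ≠ 0 → ∃ m' ∈ P.support, ∀ j, m j ≠ 0 → m' j ≠ 0) →
        R.vars.card ≤ N := by
      intro R hRi hRsub
      have hsub : R.vars ⊆ P.vars.erase i := by
        intro j hj
        obtain ⟨d, hd, hjd⟩ := (mem_vars_iff_mem_support j).mp hj
        rw [Finset.mem_erase]
        refine ⟨?_, ?_⟩
        · rintro rfl
          exact (Finsupp.mem_support_iff.mp hjd) (hRi d hd)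
        · obtain ⟨m', hm', hmm'⟩ := hRsub d hd (mem_support_iff.mp hd)
          exact (mem_vars_iff_mem_support j).mpr
            ⟨m', hm', Finsupp.mem_support_iff.mpr (hmm' j (Finsupp.mem_support_iff.mp hjd))⟩
      calc R.vars.card ≤ (P.vars.erase i).card := Finset.card_le_card hsub
        _ ≤ N := by rw [Finset.card_erase_of_mem hi]; omega
    have hN₁ : P₁.vars.card ≤ N := by
      refine hvars_sub P₁ hfree₁ fun m hm _ => ?_
      rw [mem_support_iff, hcP₁] at hm
      refine ⟨_, mem_support_iff.mpr hm, fun j hj => ?_⟩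
      simp only [Finsupp.add_apply]
      omega
    have hN₀ : P₀.vars.card ≤ N := by
      refine hvars_sub P₀ hfree₀ fun m hm _ => ?_
      rw [mem_support_iff, hcP₀] at hm
      split_ifs at hm with h
      · exact ⟨m, mem_support_iff.mpr hm, fun j hj => hj⟩
      · exact absurd rfl hm
    -- `|supp P| ≤ |supp P₁| + |supp P₀|`
    have hsuppP : P.support ⊆ P₁.support.image (· + Finsupp.single i 1) ∪ P₀.support := by
      intro m hm
      rw [Finset.mem_union]
      by_cases hmi : m i = 0
      · right
        rw [mem_support_iff, hcP₀, if_pos hmi]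
        exact mem_support_iff.mp hm
      · left
        have hmi1 : m i = 1 := by have := hP m hm i; omega
        refine Finset.mem_image.mpr ⟨m - Finsupp.single i 1, ?_, ?_⟩
        · rw [mem_support_iff, hcP₁]
          have : Finsupp.single i 1 + (m - Finsupp.single i 1) = m := by
            ext j
            simp only [Finsupp.add_apply, Finsupp.tsub_apply, Finsupp.single_apply]
            split_ifs with h
            · subst h; omega
            · omega
          rw [this]
          exact mem_support_iff.mp hm
        · ext j
          simp only [Finsupp.add_apply, Finsupp.tsub_apply, Finsupp.single_apply]
          split_ifs with h
          · subst h; omega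
          · omega
    have hcardP : P.support.card ≤ P₁.support.card + P₀.support.card :=
      calc P.support.card ≤ (P₁.support.image (· + Finsupp.single i 1) ∪ P₀.support).card :=
            Finset.card_le_card hsuppP
        _ ≤ (P₁.support.image (· + Finsupp.single i 1)).card + P₀.support.card :=
            Finset.card_union_le _ _
        _ ≤ P₁.support.card + P₀.support.card :=
            Nat.add_le_add_right Finset.card_image_le _
    -- the extreme `X_i`-degrees of `Q`
    obtain ⟨mlo, hmlo, hmin⟩ : ∃ m₀ ∈ Q.support, ∀ m ∈ Q.support, m₀ i ≤ m i :=
      Q.support.exists_min_image (fun m => m i) (support_nonempty.mpr hQ)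
    obtain ⟨mhi, hmhi, hmax⟩ : ∃ m₁ ∈ Q.support, ∀ m ∈ Q.support, m i ≤ m₁ i :=
      Q.support.exists_max_image (fun m => m i) (support_nonempty.mpr hQ)
    have hQD : weightedHomogeneousComponent (Pi.single i 1) (mhi i) Q ≠ 0 := slice_ne_zero i hmhi
    have hQd : weightedHomogeneousComponent (Pi.single i 1) (mlo i) Q ≠ 0 := slice_ne_zero i hmlo
    -- assemble
    calc P.support.card ≤ P₁.support.card + P₀.support.card := hcardP
      _ ≤ (P₁ * weightedHomogeneousComponent (Pi.single i 1) (mhi i) Q).support.card +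
            (P₀ * weightedHomogeneousComponent (Pi.single i 1) (mlo i) Q).support.card :=
          Nat.add_le_add (ih P₁ hN₁ hml₁ _ hQD) (ih P₀ hN₀ hml₀ _ hQd)
      _ ≤ ((X i * P₁ + P₀) * Q).support.card :=
          card_add_card_le_card_support_mul i hfree₀ hfree₁ hmin hmax
      _ = (P * Q).support.card := by rw [hdecomp]

end Lemma33Proof

end Literature.Computability.AlgebraicComplexity

end
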